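import Mathlib
import Literature.MathematicalPhysics.QuantumFieldTheory.Balaban1983to89.B5Ineq137

/-!
# `Balaban1983to89.B5Ineq113` — "The proof of (1.113) is similar" (B5 Prop. 1.2), kernel-checked

B5 = T. Bałaban, *Propagators and renormalization transformations for lattice gauge theories. I*,
Commun. Math. Phys. **95**, 17–40 (1984) [Balaban1984PropagatorsI]; its reference [2] = B4 = T. Bałaban,
*Regularity and decay of lattice Green's functions*, Commun. Math. Phys. **89**, 571–597 (1983)
[Balaban1983RegularityDecay].  Journal page of B5 = PDF page + 16, of B4 = PDF page + 570.

CITATION HEADER (lean-in-tree rule 2026-08-18).  This module is a TYPED SKELETON of ONE printed sentence, the last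
but one of the proof of B5 Prop. 1.2 (p. 40 [PDF 24]), verbatim: *"i.e., the inequality (1.112) with δ₀ = ½δ′₀. The
proof of (1.113) is similar. Thus we have finished the proof of Proposition 1.2."*  The entry (1.113) of Prop. 1.2
(p. 36 [PDF 20]) reads, verbatim: *"‖ζ∇G∇*J‖_α ≤ O(1)e^{−δ₀|y−y′|}(‖ζ‖_α + |ζ|)(‖J‖_{α+ε} + |J|) (1.113) for
0 ≤ α < 1, ε > 0, α + ε < 1, ζ ∈ C₀^∞(Δ̃(y)), supp J ⊂ Δ̃(y′), with the constant O(1) depending on d, α and ε(O(1) → ∞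
if α → 1 or ε → 0)."*, the Hölder norm being (1.109) p. 35: *"‖A‖_α = max_μ sup_{x,x′:|x−x′|≤1} |x − x′|^{−α}|A_μ(x) −
A_μ(x′)|"*.  NOTHING of the "similar" proof is printed.  The sibling module `B5Ineq137` (pv07-g3) kernel-checks the
displayed computation (1.135)–(1.137) ⟹ (1.112) and carries (1.113) as the BARE named hypothesis `h113` of
`B5Ineq137.h137_of_display136` (cell GAPS C-pv07-6; C-B5-17, clause (1.113)).  Here that hypothesis is DISCHARGED
modulo located leaves (`h113_of_display136`) and re-inserted (`h137_of_display136'`, `prop12G0_of_B4_via137_113`).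
What "similar" has to mean is reconstructed, over the SAME carrier `B5Ineq137.ScaleData` and the SAME display
(1.136), from the one ingredient the print names for it on p. 39 — *"In paper [2] we have proved all the necessary
properties of G′, except the second order inequalities (1.112), (1.113). … We use Lemma 2.4 of that paper"* — namely
the Hölder estimate (2.36) of [2] Lemma 2.4 (p. 582 [PDF 12], verbatim): *"|x−x′|^{−α}|(∂^{L^{−j}}_μG_j(□)Q*_j)(x, y) −
(∂^{L^{−j}}_μG_j(□)Q*_j)(x′, y)| ≤ c₁e^{−δ₀dist({x,x′},y)}, (2.36)"*, whose own one-derivative use is [2] (2.38)–(2.39)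
p. 582.

WHAT IS KERNEL-CHECKED HERE (elementary real arithmetic over the abstract FINITE carriers of `B5Ineq137.ScaleData`;
finite sums, no measure theory):
  (1.136) [`Display136`] + ∂*_ν1 = 0 at kernel level [`RowZero`] + (2.35)/(2.37) [`Leaf235to237`] + (2.36) on the
  kernel K1 [`Leaf236`] + lattice geometry, row sums, norm facts
  ⟹ the Hölder difference estimate behind (1.113), for x₁ ∈ Δ̃(y), 0 < |x₁ − x₂| ≤ 1, supp f ⊂ Δ̃(y′):
     |(∂_μG′_k∂*_νf)(x₁) − (∂_μG′_k∂*_νf)(x₂)| ≤ O(1)e^{−(1/2)δ′₀|y−y′|}(‖f‖_{α+ε} + |f|)|x₁ − x₂|^α and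
     |(∂_μG′_k∂*_νf)(x₂)| ≤ O(1)e^{−(1/2)δ′₀|y−y′|}(‖f‖_{α+ε} + |f|),
     O(1) = 4(2(c₀ + ā²c₀³R²) + ā²c₁c₀²R²)e^{(1/2)δ′₀(c+1)}Λ/(L^ε − 1)            (`ineq113At_of_display136`)
— the pieces: ∂*_ν1 = 0 makes every scale-j term of (1.136) a row-sum-zero operator, so the difference at x₁, x₂ is
Σ_{x′}L^{−jd}(W_j(x₁,x′) − W_j(x₂,x′))(f(x′) − f(x₁)) (`termT_sub`); (2.36) + (2.35)/(2.37) convolve to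
|W_j(x₁,x′) − W_j(x₂,x′)| ≤ ā²c₁c₀²R²(L^{k−j}|x₁−x₂|)^α[e^{−(3/4)δ′₀D̃₁} + e^{−(3/4)δ′₀D̃₂}] (`kerW_holder`,
D̃ᵢ = |(L^jη)^{−1}(xᵢ − x′)|); the x′ sum with the Hölder weight of exponent α + ε, the support bookkeeping and the
Riemann sum exactly as in (1.137) (`center_sum_le`, re-used from the (1.137) arithmetic); and the SCALE SPLIT that
the two-derivative case forces (not needed in [2] (2.38)–(2.39), one derivative): scales with L^{k−j}|x₁ − x₂| ≥ 1
are bounded crudely by |T_j(x₁)| + |T_j(x₂)| and (L^jη)^{α+ε} ≤ |x₁−x₂|^α(L^jη)^ε (`termT_diff_crude_le`,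
`scale_pow_crude_le`), scales with L^{k−j}|x₁ − x₂| < 1 by the Hölder bound of the kernel and
(L^{k−j}ρ)^α(L^jη)^{α+ε} = ρ^α(L^jη)^ε, (L^{k−j}ρ)^αρ^{α+ε} ≤ ρ^α(L^jη)^ε (`termT_diff_fine_le`, `scale_pow_fine_eq`,
`scale_pow_fine_le`); both feed the scale sum
Σ_j(L^jη)^ε ≤ 1/(L^ε − 1) of `B5FromB4.scale_sum_bound` ("O(1) → ∞ if ε → 0"; the printed "→ ∞ if α → 1" is c₁ =
c₁(α) of (2.36));
  the difference estimate ⟹ the entry (1.113) of Prop. 1.2 for G′                    (`h2Entry_of_ineq113`, via `Dict113`);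
  [2] Lemma 2.4 (2.36) (`B4.Lemma24Printed`, BY NAME, its "for α < 1 … c₁" clause) ⟹ the leaf `Leaf236`
                                                                                       (`leaf236_of_lemma24`, via `Dict236`);
  the family assembly = the hypothesis `h113` of `B5Ineq137.h137_of_display136`      (`h113_of_display136`), and its
insertion (`h137_of_display136'`, `prop12G0_of_B4_via137_113`).
WHAT REMAINS A NAMED HYPOTHESIS (= located leaves; cell GAPS C-B5-19 which refines C-pv07-6 / C-B5-17):
* everything `B5Ineq137` already names (`Display136`, `Dict24`, the model-evident `Geometry` / `RowSums` /
  `NormFacts` / `Dict137` / `B5FromB4.ModelSigns`, |a_j| ≤ ā);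
* `Dict236` — reading the TORUS kernel K1 of (1.136) and the pair distance in instances of [2]'s Lemma 2.4 (2.36),
  printed for parallelepipeds □ only (the (2.36)-half of G-pv07-2);
* the model-evident `RowZero` (∂*_ν1 = 0 on the finite torus: the x′ row sums of K0 and K3 vanish), `Geometry113`
  (triangle inequality on T_η and |x₁ − x₂| ≥ η for x₁ ≠ x₂) and `Dict113` (‖ζg‖_α ≤ d(‖ζ‖_α + |ζ|)·b from a common
  bound b of the d² scalar differences and values, by ζg(x₁) − ζg(x₂) = ζ(x₁)(g(x₁) − g(x₂)) + (ζ(x₁) − ζ(x₂))g(x₂)) —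
  identities / evident estimates of ℤ^d invisible to the abstract carriers; none is a cited fact.
TYPING REMARKS (cell DIVERGENCE D-b05g3.1).  (i) The print gives no proof; the decomposition above is OURS and is
claimed only as a kernel-checked sufficient route from the named printed ingredients ((1.135)/(1.136), (2.35)–(2.37))
to the printed entry (1.113); in particular the scale split (crude for L^{k−j}|x₁−x₂| ≥ 1, Hölder for < 1) and the
kernel-level use of ∂*_ν1 = 0 are not in the text.  (ii) α = 0 is allowed ((1.113): "0 ≤ α < 1"); x₁ ≠ x₂ is
assumed in the difference estimate (the x₁ = x₂ pair contributes nothing to (1.109)), and |x₁ − x₂| ≥ η = L^{−k}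
(`Geometry113.lattice_sep`) is what excludes j = 0 from the Hölder regime.  (iii) Rates as in `B5Ineq137`: δ′₀ on the
kernels, ¾δ′₀ after the y, y′ convolution, ½δ′₀ on |y − y′|, ¼δ′₀ under the x′ sum; the cube constant enters as
e^{(1/2)δ′₀(c+1)} (the second point x₂ may leave Δ̃(y) by |x₁ − x₂| ≤ 1).  (iv) Constants: c₁ = c₁(α) is CHOSEN from
the "for α < 1, there exists a constant c₁" clause of Lemma 2.4 (`Classical.choice` inside `h113_of_display136`);
the final O(1) of (1.113) is d·4(2(c₀′ + ā²c₀′³R²) + ā²c₁(α)c₀′²R²)e^{(1/2)δ₀(c+1)}Λ/(L^ε − 1), c₀′ = 4c₀e^{δ₀s₀}.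

Value = typed skeleton + kernel-checked arithmetic of one UNWRITTEN "similar" proof + located leaves, NOT summit
progress.  Cell pub-balaban, unit `b2b-balaban-b05-g3` (paper sub-cell B05, gen 3; LEMMAS row T02.2(c) SHARPEN);
census ids C-B5-19, D-b05g3.1 (refining C-pv07-6, C-B5-17, G-pv07-2); sibling modules `B5Ineq137.lean` (pv07-g3),
`B5FromB4.lean` (b05-g2).
-/

namespace Literature.MathematicalPhysics.QuantumFieldTheory.Balaban1983to89.B5Ineq113

open Finset B5Ineq137

/-! ## §1. Generic real arithmetic (all [folklore], kernel-checked) -/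

/-- `e^{−δ·dist({x̃₁,x̃₂},y)} ≤ e^{−δ|x̃₁−y|} + e^{−δ|x̃₂−y|}`: if min a b ≤ m and δ ≥ 0 then
e^{−δm} ≤ e^{−δa} + e^{−δb}. [folklore] -/
theorem exp_min_le_add {δ m a b : ℝ} (hδ : 0 ≤ δ) (hm : min a b ≤ m) :
    Real.exp (-(δ * m)) ≤ Real.exp (-(δ * a)) + Real.exp (-(δ * b)) := by
  rcases le_total a b with hab | hab
  · rw [min_eq_left hab] at hm
    have h1 : Real.exp (-(δ * m)) ≤ Real.exp (-(δ * a)) :=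
      Real.exp_le_exp.mpr (by nlinarith [mul_le_mul_of_nonneg_left hm hδ])
    linarith [Real.exp_nonneg (-(δ * b))]
  · rw [min_eq_right hab] at hm
    have h1 : Real.exp (-(δ * m)) ≤ Real.exp (-(δ * b)) :=
      Real.exp_le_exp.mpr (by nlinarith [mul_le_mul_of_nonneg_left hm hδ])
    linarith [Real.exp_nonneg (-(δ * a))]

/-- The scale algebra of the Hölder regime L^{k−j}ρ < 1 (s = L^jη = L^{j−k}, N = (L^jη)^{−1} = L^{k−j}, sN = 1):
`(Nρ)^α · s^{α+ε} = ρ^α · s^ε`. [folklore] -/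
theorem scale_pow_fine_eq {s N ρ α ε : ℝ} (hs : 0 < s) (hN : 0 ≤ N) (hρ : 0 ≤ ρ) (hsN : s * N = 1) :
    (N * ρ) ^ α * s ^ (α + ε) = ρ ^ α * s ^ ε := by
  rw [Real.mul_rpow hN hρ, Real.rpow_add hs]
  have h1 : N ^ α * s ^ α = 1 := by
    rw [← Real.mul_rpow hN hs.le, mul_comm N s, hsN, Real.one_rpow]
  calc N ^ α * ρ ^ α * (s ^ α * s ^ ε) = (N ^ α * s ^ α) * (ρ ^ α * s ^ ε) := by ring
    _ = ρ ^ α * s ^ ε := by rw [h1, one_mul]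

/-- The scale algebra of the Hölder regime, second piece: for Nρ ≤ 1, 0 ≤ α, 0 < ε (s, N, ρ as in
`scale_pow_fine_eq`): `(Nρ)^α · ρ^{α+ε} ≤ ρ^α · s^ε` (since ρ^ε = s^ε(Nρ)^ε and (Nρ)^{α+ε} ≤ 1). [folklore] -/
theorem scale_pow_fine_le {s N ρ α ε : ℝ} (hs : 0 < s) (hN : 0 ≤ N) (hρ : 0 ≤ ρ) (hsN : s * N = 1)
    (hα : 0 ≤ α) (hε : 0 < ε) (hfine : N * ρ ≤ 1) :
    (N * ρ) ^ α * ρ ^ (α + ε) ≤ ρ ^ α * s ^ ε := by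
  have hNρ : 0 ≤ N * ρ := mul_nonneg hN hρ
  have hne : α + ε ≠ 0 := (add_pos_of_nonneg_of_pos hα hε).ne'
  have h1 : ρ ^ ε = s ^ ε * (N * ρ) ^ ε := by
    rw [← Real.mul_rpow hs.le hNρ, ← mul_assoc, hsN, one_mul]
  have h2 : (N * ρ) ^ (α + ε) ≤ 1 := Real.rpow_le_one hNρ hfine (by linarith)
  have h3 : (N * ρ) ^ (α + ε) = (N * ρ) ^ α * (N * ρ) ^ ε := Real.rpow_add' hNρ hne
  have h4 : 0 ≤ ρ ^ α * s ^ ε := mul_nonneg (Real.rpow_nonneg hρ _) (Real.rpow_nonneg hs.le _)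
  calc (N * ρ) ^ α * ρ ^ (α + ε) = (N * ρ) ^ α * (ρ ^ α * ρ ^ ε) := by rw [Real.rpow_add' hρ hne]
    _ = ρ ^ α * s ^ ε * ((N * ρ) ^ α * (N * ρ) ^ ε) := by rw [h1]; ring
    _ = ρ ^ α * s ^ ε * (N * ρ) ^ (α + ε) := by rw [h3]
    _ ≤ ρ ^ α * s ^ ε * 1 := mul_le_mul_of_nonneg_left h2 h4
    _ = ρ ^ α * s ^ ε := mul_one _

/-- The scale algebra of the crude regime L^{k−j}ρ ≥ 1, i.e. s ≤ ρ: `s^{α+ε} ≤ ρ^α · s^ε` (0 ≤ α). [folklore] -/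
theorem scale_pow_crude_le {s ρ α ε : ℝ} (hs : 0 < s) (hα : 0 ≤ α) (hcrude : s ≤ ρ) :
    s ^ (α + ε) ≤ ρ ^ α * s ^ ε := by
  rw [Real.rpow_add hs]
  exact mul_le_mul_of_nonneg_right (Real.rpow_le_rpow hs.le hcrude hα) (Real.rpow_nonneg hs.le _)

/-- `1/(L^{α+ε} − 1) ≤ 1/(L^ε − 1)` for L > 1, ε > 0, α ≥ 0: the scale sum at exponent α + ε is dominated by the one
at exponent ε. [folklore] -/
theorem inv_scale_gap_mono {L α ε : ℝ} (hL : 1 < L) (hε : 0 < ε) (hα : 0 ≤ α) :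
    1 / (L ^ (α + ε) - 1) ≤ 1 / (L ^ ε - 1) := by
  have h1 : L ^ ε ≤ L ^ (α + ε) := Real.rpow_le_rpow_of_exponent_le hL.le (by linarith)
  have h2 : 0 < L ^ ε - 1 := by
    have := Real.one_lt_rpow hL hε
    linarith
  exact one_div_le_one_div_of_le h2 (by linarith)


/-! ## §2. The scale-j term of (1.136), the additional leaves, and the difference estimate behind (1.113) -/

variable {S : B5.Setting}

/-- The scale-j term of the display (1.136) at the point x:
T_j(x) = Σ_{x′∈T_η} L^{−jd} W_j(x, x′)(f(x′) − f(x)) (W_j = `B5Ineq137.kerW`; j = 0 is the C^{(0)} term), so that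
(1.136) reads (∂_μG′_k∂*_νf)(x) = Σ_{j=0}^{k−1} T_j(x). [cite: Balaban1984PropagatorsI, (1.136) pp.39–40] -/
noncomputable def termT (D : ScaleData S) (L : ℝ) (d : ℕ) (j : ℕ) (μ ν : D.Dir) (f : D.F) (x : D.X) : ℝ :=
  ∑ x' ∈ D.TX, (L ^ (j * d))⁻¹ * kerW D j μ ν x x' * (D.eval f x' - D.eval f x)

/-- ∂*_ν1 = 0 AT KERNEL LEVEL on the finite torus — the fact that lets (1.136) be written with the differences
f(x′) − f(x) at all ((∂_μG′_k∂*_νf)(x) = Σ_{x′}η^d(∂_μG′_k∂*_ν)(x, x′)f(x′) and Σ_{x′}(∂_μG′_k∂*_ν)(x, x′) = 0), read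
on the two kernels of (1.136) that carry ∂*_ν: the x′ row sums of K0 (the kernel of ∂_μC^{(0),η}∂*_ν) and of
K3 = (Q′_jG′_j∂^{L^{−j}*}_ν)(y, ·) vanish.  An identity of the model (a finite torus, sums over all of T_η),
invisible to the abstract carrier; an explicit hypothesis, not a cited fact. [folklore] -/
structure RowZero (D : ScaleData S) : Prop where
  zero : ∀ (μ ν : D.Dir) (x : D.X), x ∈ D.TX → ∑ x' ∈ D.TX, D.K0 μ ν x x' = 0
  mid : ∀ j : ℕ, 1 ≤ j → j < S.k → ∀ (ν : D.Dir) (y : D.U), ∑ x' ∈ D.TX, D.K3 j ν y x' = 0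

/-- **The estimate (2.36) of Lemma 2.4 in [2] as used for (1.113)**, on the kernel K1 of (1.136) in its fine
argument x̃ = (L^jη)^{−1}x (an L^{−j}-lattice point; |x̃₁ − x̃₂| = L^{k−j}|x₁ − x₂|, η = L^{−k}), at rate δ′₀, with
e^{−δ′₀dist({x̃₁,x̃₂},y)} ≤ e^{−δ′₀|x̃₁−y|} + e^{−δ′₀|x̃₂−y|}: for 1 ≤ j ≤ k − 1 and x₁ ≠ x₂,
|K1(x₁,y) − K1(x₂,y)| ≤ c₁(L^{k−j}|x₁−x₂|)^α(e^{−δ′₀|x̃₁−y|} + e^{−δ′₀|x̃₂−y|}).  [2] prints (2.36) for parallelepipeds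
□ only; its torus reading is B5's assertion (p. 39) — a LOCATED LEAF, discharged from `B4.Lemma24Printed` by name
through `Dict236` (`leaf236_of_lemma24`). [cite: Balaban1983RegularityDecay, Lemma 2.4 (2.36) p.582; Balaban1984PropagatorsI, p.39] -/
def Leaf236 (D : ScaleData S) (L α c₁ δ₀' : ℝ) : Prop :=
  ∀ j : ℕ, 1 ≤ j → j < S.k → ∀ (μ : D.Dir) (x₁ x₂ : D.X) (y : D.U), x₁ ≠ x₂ →
    |D.K1 j μ x₁ y - D.K1 j μ x₂ y| ≤
      c₁ * (L ^ (S.k - j) * D.distX x₁ x₂) ^ α *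
        (Real.exp (-(δ₀' * D.dXU j x₁ y)) + Real.exp (-(δ₀' * D.dXU j x₂ y)))

/-- The (2.36)-half of the dictionary `B5Ineq137.Dict24` between the kernels of (1.136) on the TORUS and the
instances of [2]'s Lemma 2.4 (`B4.ScaleSetting`; its field `lhs236 α μ x x′ y` is the left-hand side
|x−x′|^{−α}|(∂^{L^{−j}}_μG_j(□)Q*_j)(x, y) − (∂^{L^{−j}}_μG_j(□)Q*_j)(x′, y)| of (2.36) and `dist2F x x′ y` = dist({x,x′}, y)):
for 1 ≤ j ≤ k − 1 the kernel K1 of the j-th term is read in an instance with `rectLarge`, the Hölder quotient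
multiplied back by |x̃₁ − x̃₂|^α = (L^{k−j}|x₁ − x₂|)^α, and dist({x̃₁,x̃₂}, y) ≥ min(|x̃₁ − y|, |x̃₂ − y|).  As for
`Dict24`: [2] prints Lemma 2.4 for parallelepipeds □ ⊂ L^{−j}ℤ^d only; reading the torus kernel there is B5's
assertion "(2.34) with □ replaced by the whole torus" (p. 39), not a printed theorem of [2] — located leaf (cell GAPS
G-pv07-2 / C-B5-19). [cite: Balaban1984PropagatorsI, p.39; Balaban1983RegularityDecay, Lemma 2.4 (2.36) p.582] -/
structure Dict236 {I₂₄ : Type} (fam₂₄ : I₂₄ → B4.ScaleSetting) (D : ScaleData S) (L : ℝ) : Prop where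
  mid : ∀ j : ℕ, 1 ≤ j → j < S.k → ∃ i : I₂₄, (fam₂₄ i).rectLarge ∧
    ∃ (σ : D.X → (fam₂₄ i).SiteF) (τ : D.U → (fam₂₄ i).SiteU) (dir : D.Dir → (fam₂₄ i).Dir),
      (∀ (α : ℝ) (μ : D.Dir) (x₁ x₂ : D.X) (y : D.U), x₁ ≠ x₂ →
        |D.K1 j μ x₁ y - D.K1 j μ x₂ y| ≤
          (fam₂₄ i).lhs236 α (dir μ) (σ x₁) (σ x₂) (τ y) * (L ^ (S.k - j) * D.distX x₁ x₂) ^ α) ∧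
      (∀ (x₁ x₂ : D.X) (y : D.U),
        min (D.dXU j x₁ y) (D.dXU j x₂ y) ≤ (fam₂₄ i).dist2F (σ x₁) (σ x₂) (τ y))

/-- Two more model-evident facts of the torus T_η needed by the difference estimate (and invisible to the abstract
carrier): the triangle inequality |x − z| ≤ |x − y| + |y − z| on T_η, and the lattice separation |x₁ − x₂| ≥ η =
L^{−k} for x₁ ≠ x₂ ((1.18) p. 20), i.e. 1 ≤ L^k|x₁ − x₂|. [folklore] -/
structure Geometry113 (D : ScaleData S) (L : ℝ) : Prop where
  triX : ∀ x y z : D.X, D.distX x z ≤ D.distX x y + D.distX y z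
  lattice_sep : ∀ x₁ x₂ : D.X, x₁ ≠ x₂ → 1 ≤ L ^ S.k * D.distX x₁ x₂

/-- The dictionary between the scalar difference estimate and the entry (1.113) of `B5.Setting`
(`h2 J α ζ` = ‖ζ∇G′∇*J‖_α of (1.109), `cutH α ζ` = ‖ζ‖_α + |ζ|, `cutIn ζ y` = ζ ∈ C₀^∞(Δ̃(y))): if b bounds, for
every pair x₁ ≠ x₂ of T_η with |x₁ − x₂| ≤ 1 and x₁ ∈ Δ̃(y), both |x₁ − x₂|^{−α}|(∂_μG′∂*_νJ_ν)(x₁) − (∂_μG′∂*_νJ_ν)(x₂)|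
and |(∂_μG′∂*_νJ_ν)(x₂)| (all μ, ν), then ‖ζ∇G′∇*J‖_α ≤ d(‖ζ‖_α + |ζ|)b — by (1.109) (a pair contributes only if
one of its points, call it x₁, lies in supp ζ ⊂ Δ̃(y)), g_μ = Σ_ν∂_μG′∂*_νJ_ν, and
ζ(x₁)g(x₁) − ζ(x₂)g(x₂) = ζ(x₁)(g(x₁) − g(x₂)) + (ζ(x₁) − ζ(x₂))g(x₂).  An identity-level fact of the model,
invisible to the carriers; an explicit hypothesis, not a cited fact. [folklore] -/
structure Dict113 (D : ScaleData S) (d : ℕ) : Prop where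
  h2_le : ∀ (J : S.Loc) (α : ℝ) (ζ : S.Cut) (y : S.Site) (b : ℝ), 0 ≤ b → S.cutIn ζ y →
    (∀ (μ ν : D.Dir) (x₁ x₂ : D.X), x₁ ∈ D.TX → x₂ ∈ D.TX → x₁ ≠ x₂ → D.distX x₁ x₂ ≤ 1 →
        D.cube x₁ y →
      |D.E μ ν (D.comp J ν) x₁ - D.E μ ν (D.comp J ν) x₂| ≤ b * D.distX x₁ x₂ ^ α ∧
        |D.E μ ν (D.comp J ν) x₂| ≤ b) →
    S.h2 J α ζ ≤ d * S.cutH α ζ * b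

/-- **The difference estimate behind (1.113)** (the "similar" analogue of (1.137), at a FIXED α ≥ 0): for
0 < ε, α + ε < 1, x₁, x₂ ∈ T_η, x₁ ≠ x₂, |x₁ − x₂| ≤ 1, x₁ ∈ Δ̃(y), supp f ⊂ Δ̃(y′),
|(∂_μG′_k∂*_νf)(x₁) − (∂_μG′_k∂*_νf)(x₂)| ≤ Cε(ε)e^{−δ|y−y′|}(‖f‖_{α+ε} + |f|)|x₁ − x₂|^α and
|(∂_μG′_k∂*_νf)(x₂)| ≤ Cε(ε)e^{−δ|y−y′|}(‖f‖_{α+ε} + |f|), with the ε-dependent constant and the rate as parameters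
(`ineq113At_of_display136` gives δ = ½δ′₀ and an explicit Cε). [cite: Balaban1984PropagatorsI, (1.113) p.36, p.40] -/
def Ineq113At (D : ScaleData S) (α : ℝ) (Cε : ℝ → ℝ) (δ : ℝ) : Prop :=
  ∀ (ε : ℝ) (μ ν : D.Dir) (f : D.F) (x₁ x₂ : D.X) (y y' : S.Site), 0 < ε → α + ε < 1 →
    x₁ ∈ D.TX → x₂ ∈ D.TX → x₁ ≠ x₂ → D.distX x₁ x₂ ≤ 1 → D.cube x₁ y → suppF D f y' →
    |D.E μ ν f x₁ - D.E μ ν f x₂| ≤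
        Cε ε * Real.exp (-(δ * S.dist y y')) * (D.holderF (α + ε) f + D.supF f) * D.distX x₁ x₂ ^ α ∧
      |D.E μ ν f x₂| ≤ Cε ε * Real.exp (-(δ * S.dist y y')) * (D.holderF (α + ε) f + D.supF f)


/-! ## §3. Kernel-checked: the pieces of the difference estimate -/

/-- ∂*_ν1 = 0 ⟹ every kernel W_j of (1.136) has vanishing x′ row sums (j = 0: K0 directly; j ≥ 1: the y, y′ sums
commute with the x′ sum and Σ_{x′}K3(y′, x′) = 0). [folklore] -/
theorem kerW_rowsum_zero (D : ScaleData S) (Z : RowZero D) {j : ℕ} (hj : j < S.k) (μ ν : D.Dir) (x : D.X)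
    (hx : x ∈ D.TX) : ∑ x' ∈ D.TX, kerW D j μ ν x x' = 0 := by
  rcases Nat.eq_zero_or_pos j with hj0 | hjpos
  · subst hj0
    simp only [kerW, if_true]
    exact Z.zero μ ν x hx
  · have hjne : j ≠ 0 := Nat.pos_iff_ne_zero.mp hjpos
    simp only [kerW, if_neg hjne]
    have h3 : ∀ y₂ : D.U, ∑ x' ∈ D.TX, D.K3 j ν y₂ x' = 0 := fun y₂ => Z.mid j hjpos hj ν y₂
    have inner : ∑ x' ∈ D.TX, ∑ y₁ ∈ D.TU j, ∑ y₂ ∈ D.TU j,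
        D.K1 j μ x y₁ * D.K2 j y₁ y₂ * D.K3 j ν y₂ x' = 0 := by
      rw [Finset.sum_comm]
      refine Finset.sum_eq_zero fun y₁ _ => ?_
      rw [Finset.sum_comm]
      refine Finset.sum_eq_zero fun y₂ _ => ?_
      rw [← Finset.mul_sum, h3 y₂, mul_zero]
    rw [← Finset.mul_sum, inner, mul_zero]

/-- Row sum zero ⟹ the difference of the scale-j term at two points is a kernel DIFFERENCE against f(x′) − f(x₁):
T_j(x₁) − T_j(x₂) = Σ_{x′}L^{−jd}(W_j(x₁,x′) − W_j(x₂,x′))(f(x′) − f(x₁)). [folklore] -/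
theorem termT_sub (D : ScaleData S) (L : ℝ) (d : ℕ) (Z : RowZero D) {j : ℕ} (hj : j < S.k) (μ ν : D.Dir)
    (f : D.F) (x₁ x₂ : D.X) (hx₂ : x₂ ∈ D.TX) :
    termT D L d j μ ν f x₁ - termT D L d j μ ν f x₂ =
      ∑ x' ∈ D.TX, (L ^ (j * d))⁻¹ * (kerW D j μ ν x₁ x' - kerW D j μ ν x₂ x') *
        (D.eval f x' - D.eval f x₁) := by
  have h0 : ∑ x' ∈ D.TX, (L ^ (j * d))⁻¹ * kerW D j μ ν x₂ x' * (D.eval f x₁ - D.eval f x₂) = 0 := by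
    rw [← Finset.sum_mul, ← Finset.mul_sum, kerW_rowsum_zero D Z hj μ ν x₂ hx₂, mul_zero, zero_mul]
  have h1 : termT D L d j μ ν f x₂ =
      ∑ x' ∈ D.TX, (L ^ (j * d))⁻¹ * kerW D j μ ν x₂ x' * (D.eval f x' - D.eval f x₁) := by
    unfold termT
    have hsplit : ∀ x' ∈ D.TX, (L ^ (j * d))⁻¹ * kerW D j μ ν x₂ x' * (D.eval f x' - D.eval f x₂) =
        (L ^ (j * d))⁻¹ * kerW D j μ ν x₂ x' * (D.eval f x' - D.eval f x₁) +
          (L ^ (j * d))⁻¹ * kerW D j μ ν x₂ x' * (D.eval f x₁ - D.eval f x₂) := by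
      intro x' _; ring
    rw [Finset.sum_congr rfl hsplit, Finset.sum_add_distrib, h0, add_zero]
  rw [h1]
  unfold termT
  rw [← Finset.sum_sub_distrib]
  refine Finset.sum_congr rfl fun x' _ => ?_
  ring

/-- **The x′ sum of (1.137) around a centre x**, re-usable for both points of the difference estimate: if every x′
with f(x′) ≠ f(x) has |x − x′| ≥ |y − y′| − c′ (support bookkeeping), then for 0 < e ≤ 1
Σ_{x′}L^{−jd}e^{−(3/4)δD̃}|f(x′) − f(x)| ≤ e^{(1/2)δc′}e^{−(1/2)δ|y−y′|}(‖f‖_e + 2|f|)Λ(L^jη)^e, D̃ = |(L^jη)^{−1}(x − x′)| —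
the Hölder weight |f(x′) − f(x)| ≤ (‖f‖_e + 2|f|)|x − x′|^e (`B5Ineq137.holder_split`), |x − x′|^e = (L^jη)^eD̃^e
(`B5Ineq137.scale_cancel`), D̃^e ≤ 1 + D̃, e^{−(3/4)δD̃} ≤ e^{(1/2)δc′}e^{−(1/2)δ|y−y′|}e^{−(1/4)δD̃}
(`B5Ineq137.exp_three_quarter_split`) and the Riemann sum ≤ Λ (`RowSums.lat`). [cite: Balaban1984PropagatorsI, (1.137) p.40] -/
theorem center_sum_le (D : ScaleData S) (L : ℝ) (d : ℕ) (δ cc c' t R Λ e : ℝ) (hL : 1 < L) (hδ : 0 ≤ δ)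
    (he0 : 0 < e) (he1 : e ≤ 1) (G : Geometry D L cc) (Rw : RowSums D L d (δ / 4) R Λ) (N : NormFacts D)
    {j : ℕ} (hj : j < S.k) (f : D.F) (x : D.X) (hx : x ∈ D.TX)
    (hsep : ∀ x' ∈ D.TX, D.eval f x' - D.eval f x ≠ 0 → t - c' ≤ D.distX x x') :
    ∑ x' ∈ D.TX, (L ^ (j * d))⁻¹ * Real.exp (-(3 / 4 * δ * (L ^ (S.k - j) * D.distX x x'))) *
        |D.eval f x' - D.eval f x| ≤
      Real.exp (δ / 2 * c') * Real.exp (-(δ / 2 * t)) * (D.holderF e f + 2 * D.supF f) * Λ *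
        (L ^ ((j : ℝ) - S.k)) ^ e := by
  have hL0 : 0 < L := lt_trans zero_lt_one hL
  have hH0 : 0 ≤ D.holderF e f := N.holder_nonneg e f
  have hM0 : 0 ≤ D.supF f := N.sup_nonneg f
  obtain ⟨A, hA⟩ : ∃ A : ℝ, A = Real.exp (δ / 2 * c') * Real.exp (-(δ / 2 * t)) *
      (D.holderF e f + 2 * D.supF f) := ⟨_, rfl⟩
  have hA0 : 0 ≤ A := by rw [hA]; positivity
  have hsc : 0 ≤ (L ^ ((j : ℝ) - S.k)) ^ e := Real.rpow_nonneg (Real.rpow_nonneg hL0.le _) _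
  have key : ∀ x' ∈ D.TX,
      (L ^ (j * d))⁻¹ * Real.exp (-(3 / 4 * δ * (L ^ (S.k - j) * D.distX x x'))) *
          |D.eval f x' - D.eval f x| ≤
        A * (L ^ ((j : ℝ) - S.k)) ^ e * ((L ^ (j * d))⁻¹ *
          (Real.exp (-(δ / 4 * (L ^ (S.k - j) * D.distX x x'))) * (1 + L ^ (S.k - j) * D.distX x x'))) := by
    intro x' hx'
    have hdX : 0 ≤ D.distX x x' := G.distX_nonneg x x'
    have hDt0 : 0 ≤ L ^ (S.k - j) * D.distX x x' := mul_nonneg (pow_nonneg hL0.le _) hdX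
    have hLjd : 0 < (L ^ (j * d))⁻¹ := inv_pos.mpr (pow_pos hL0 _)
    have hw0 : 0 ≤ (L ^ (j * d))⁻¹ * (Real.exp (-(δ / 4 * (L ^ (S.k - j) * D.distX x x'))) *
        (1 + L ^ (S.k - j) * D.distX x x')) :=
      mul_nonneg hLjd.le (mul_nonneg (Real.exp_nonneg _) (by linarith))
    by_cases hzero : D.eval f x' - D.eval f x = 0
    · rw [hzero, abs_zero, mul_zero]
      exact mul_nonneg (mul_nonneg hA0 hsc) hw0
    · have hsepD : t - c' ≤ L ^ (S.k - j) * D.distX x x' :=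
        (hsep x' hx' hzero).trans (dist_le_rescaled hL.le hdX _)
      have hsplit := exp_three_quarter_split hδ hsepD
      have hdistε : D.distX x x' ^ e = (L ^ ((j : ℝ) - S.k)) ^ e * (L ^ (S.k - j) * D.distX x x') ^ e := by
        rw [← Real.mul_rpow (Real.rpow_nonneg hL0.le _) hDt0, ← mul_assoc, scale_cancel hL0 hj.le, one_mul]
      have hf : |D.eval f x' - D.eval f x| ≤ (D.holderF e f + 2 * D.supF f) * D.distX x x' ^ e :=
        holder_split hdX hH0 hM0 he0 (fun h1 => N.holder_le e f x x' he0 h1) (N.sup_le f x') (N.sup_le f x)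
      have hDtε : (L ^ (S.k - j) * D.distX x x') ^ e ≤ 1 + L ^ (S.k - j) * D.distX x x' := by
        -- D̃^e ≤ 1 + D̃ for D̃ ≥ 0, 0 ≤ e ≤ 1 (= `Literature.Analysis.PDE.rpow_le_one_add`, not imported here)
        rcases le_or_gt (L ^ (S.k - j) * D.distX x x') 1 with h1 | h1
        · exact (Real.rpow_le_one hDt0 h1 he0.le).trans (by linarith)
        · exact (Real.rpow_le_self_of_one_le h1.le he1).trans (by linarith)
      have hf' : |D.eval f x' - D.eval f x| ≤ (D.holderF e f + 2 * D.supF f) *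
          ((L ^ ((j : ℝ) - S.k)) ^ e * (1 + L ^ (S.k - j) * D.distX x x')) := by
        refine hf.trans ?_
        rw [hdistε]
        exact mul_le_mul_of_nonneg_left (mul_le_mul_of_nonneg_left hDtε hsc) (by positivity)
      calc (L ^ (j * d))⁻¹ * Real.exp (-(3 / 4 * δ * (L ^ (S.k - j) * D.distX x x'))) *
            |D.eval f x' - D.eval f x|
          ≤ (L ^ (j * d))⁻¹ * (Real.exp (δ / 2 * c') * Real.exp (-(δ / 2 * t)) *
                Real.exp (-(δ / 4 * (L ^ (S.k - j) * D.distX x x')))) *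
              ((D.holderF e f + 2 * D.supF f) *
                ((L ^ ((j : ℝ) - S.k)) ^ e * (1 + L ^ (S.k - j) * D.distX x x'))) :=
            mul_le_mul (mul_le_mul_of_nonneg_left hsplit hLjd.le) hf' (abs_nonneg _) (by positivity)
        _ = A * (L ^ ((j : ℝ) - S.k)) ^ e * ((L ^ (j * d))⁻¹ *
              (Real.exp (-(δ / 4 * (L ^ (S.k - j) * D.distX x x'))) *
                (1 + L ^ (S.k - j) * D.distX x x'))) := by
            rw [hA]; ring
  calc ∑ x' ∈ D.TX, (L ^ (j * d))⁻¹ * Real.exp (-(3 / 4 * δ * (L ^ (S.k - j) * D.distX x x'))) *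
          |D.eval f x' - D.eval f x|
      ≤ ∑ x' ∈ D.TX, A * (L ^ ((j : ℝ) - S.k)) ^ e * ((L ^ (j * d))⁻¹ *
          (Real.exp (-(δ / 4 * (L ^ (S.k - j) * D.distX x x'))) * (1 + L ^ (S.k - j) * D.distX x x'))) :=
        Finset.sum_le_sum key
    _ = A * (L ^ ((j : ℝ) - S.k)) ^ e * ∑ x' ∈ D.TX, ((L ^ (j * d))⁻¹ *
          (Real.exp (-(δ / 4 * (L ^ (S.k - j) * D.distX x x'))) * (1 + L ^ (S.k - j) * D.distX x x'))) := by
        rw [Finset.mul_sum]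
    _ ≤ A * (L ^ ((j : ℝ) - S.k)) ^ e * Λ :=
        mul_le_mul_of_nonneg_left (Rw.lat j x hj hx) (mul_nonneg hA0 hsc)
    _ = Real.exp (δ / 2 * c') * Real.exp (-(δ / 2 * t)) * (D.holderF e f + 2 * D.supF f) * Λ *
          (L ^ ((j : ℝ) - S.k)) ^ e := by
        rw [hA]; ring

/-- **Crude bound of one scale-j term** |T_j(x)| ≤ (c₀ + ā²c₀³R²)e^{(1/2)δc′}e^{−(1/2)δ|y−y′|}(‖f‖_e + 2|f|)Λ(L^jη)^e —
the j-th summand of (1.137) (`B5Ineq137.kerW_bound` + `center_sum_le`), used at both points for the scales with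
L^{k−j}|x₁ − x₂| ≥ 1 and for the sup half of the estimate. [cite: Balaban1984PropagatorsI, (1.137) p.40] -/
theorem termT_abs_le (D : ScaleData S) (L : ℝ) (d : ℕ) (c₀ δ cc c' t ā R Λ e : ℝ) (hL : 1 < L)
    (hc₀ : 0 ≤ c₀) (hδ : 0 ≤ δ) (he0 : 0 < e) (he1 : e ≤ 1) (ha : ∀ j, |D.a j| ≤ ā)
    (hleaf : Leaf235to237 D L c₀ δ) (G : Geometry D L cc) (Rw : RowSums D L d (δ / 4) R Λ) (N : NormFacts D)
    {j : ℕ} (hj : j < S.k) (μ ν : D.Dir) (f : D.F) (x : D.X) (hx : x ∈ D.TX)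
    (hsep : ∀ x' ∈ D.TX, D.eval f x' - D.eval f x ≠ 0 → t - c' ≤ D.distX x x') :
    |termT D L d j μ ν f x| ≤ (c₀ + ā ^ 2 * c₀ ^ 3 * R ^ 2) *
      (Real.exp (δ / 2 * c') * Real.exp (-(δ / 2 * t)) * (D.holderF e f + 2 * D.supF f) * Λ *
        (L ^ ((j : ℝ) - S.k)) ^ e) := by
  have hL0 : 0 < L := lt_trans zero_lt_one hL
  unfold termT
  calc |∑ x' ∈ D.TX, (L ^ (j * d))⁻¹ * kerW D j μ ν x x' * (D.eval f x' - D.eval f x)|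
      ≤ ∑ x' ∈ D.TX, |(L ^ (j * d))⁻¹ * kerW D j μ ν x x' * (D.eval f x' - D.eval f x)| :=
        Finset.abs_sum_le_sum_abs _ _
    _ ≤ ∑ x' ∈ D.TX, (c₀ + ā ^ 2 * c₀ ^ 3 * R ^ 2) * ((L ^ (j * d))⁻¹ *
          Real.exp (-(3 / 4 * δ * (L ^ (S.k - j) * D.distX x x'))) * |D.eval f x' - D.eval f x|) := by
        refine Finset.sum_le_sum fun x' _ => ?_
        have hLjd : 0 < (L ^ (j * d))⁻¹ := inv_pos.mpr (pow_pos hL0 _)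
        have hW := kerW_bound D L c₀ δ cc ā R Λ d hL.le hc₀ hδ ha hleaf G Rw hj μ ν x x'
        rw [abs_mul, abs_mul, abs_of_pos hLjd]
        calc (L ^ (j * d))⁻¹ * |kerW D j μ ν x x'| * |D.eval f x' - D.eval f x|
            ≤ (L ^ (j * d))⁻¹ * ((c₀ + ā ^ 2 * c₀ ^ 3 * R ^ 2) *
                Real.exp (-(3 / 4 * δ * (L ^ (S.k - j) * D.distX x x')))) * |D.eval f x' - D.eval f x| :=
              mul_le_mul_of_nonneg_right (mul_le_mul_of_nonneg_left hW hLjd.le) (abs_nonneg _)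
          _ = (c₀ + ā ^ 2 * c₀ ^ 3 * R ^ 2) * ((L ^ (j * d))⁻¹ *
                Real.exp (-(3 / 4 * δ * (L ^ (S.k - j) * D.distX x x'))) * |D.eval f x' - D.eval f x|) := by
              ring
    _ = (c₀ + ā ^ 2 * c₀ ^ 3 * R ^ 2) * ∑ x' ∈ D.TX, ((L ^ (j * d))⁻¹ *
          Real.exp (-(3 / 4 * δ * (L ^ (S.k - j) * D.distX x x'))) * |D.eval f x' - D.eval f x|) := by
        rw [Finset.mul_sum]
    _ ≤ (c₀ + ā ^ 2 * c₀ ^ 3 * R ^ 2) *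
          (Real.exp (δ / 2 * c') * Real.exp (-(δ / 2 * t)) * (D.holderF e f + 2 * D.supF f) * Λ *
            (L ^ ((j : ℝ) - S.k)) ^ e) :=
        mul_le_mul_of_nonneg_left (center_sum_le D L d δ cc c' t R Λ e hL hδ he0 he1 G Rw N hj f x hx hsep)
          (by positivity)

/-- **Hölder bound of the kernel W_j in x** (the y, y′ summation of (1.136) with (2.36) on the first kernel and
(2.35)/(2.37) on the other two): for 1 ≤ j ≤ k − 1 and x₁ ≠ x₂,
|W_j(x₁,x′) − W_j(x₂,x′)| ≤ ā²c₁c₀²R²(L^{k−j}|x₁−x₂|)^α[e^{−(3/4)δD̃₁} + e^{−(3/4)δD̃₂}], D̃ᵢ = |(L^jη)^{−1}(xᵢ − x′)| —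
two applications of `B5Ineq137.conv_two_mid` (centres x₁ and x₂). [cite: Balaban1984PropagatorsI, (1.136) pp.39–40; Balaban1983RegularityDecay, (2.36) p.582] -/
theorem kerW_holder (D : ScaleData S) (L c₀ c₁ δ cc ā R Λ α : ℝ) (d : ℕ) (hL : 1 ≤ L) (hc₀ : 0 ≤ c₀)
    (hc₁ : 0 ≤ c₁) (hδ : 0 ≤ δ) (ha : ∀ j, |D.a j| ≤ ā) (hleaf : Leaf235to237 D L c₀ δ)
    (h236 : Leaf236 D L α c₁ δ) (G : Geometry D L cc) (Rw : RowSums D L d (δ / 4) R Λ) {j : ℕ}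
    (hj1 : 1 ≤ j) (hj : j < S.k) (μ ν : D.Dir) (x₁ x₂ x' : D.X) (hne : x₁ ≠ x₂) :
    |kerW D j μ ν x₁ x' - kerW D j μ ν x₂ x'| ≤
      ā ^ 2 * c₁ * c₀ ^ 2 * R ^ 2 * (L ^ (S.k - j) * D.distX x₁ x₂) ^ α *
        (Real.exp (-(3 / 4 * δ * (L ^ (S.k - j) * D.distX x₁ x'))) +
          Real.exp (-(3 / 4 * δ * (L ^ (S.k - j) * D.distX x₂ x')))) := by
  have hL0 : 0 ≤ L := le_trans zero_le_one hL
  have hjne : j ≠ 0 := by omega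
  have hP0 : 0 ≤ (L ^ (S.k - j) * D.distX x₁ x₂) ^ α :=
    Real.rpow_nonneg (mul_nonneg (pow_nonneg hL0 _) (G.distX_nonneg _ _)) _
  have hexp : kerW D j μ ν x₁ x' - kerW D j μ ν x₂ x' = D.a j ^ 2 * ∑ y₁ ∈ D.TU j, ∑ y₂ ∈ D.TU j,
      (D.K1 j μ x₁ y₁ - D.K1 j μ x₂ y₁) * D.K2 j y₁ y₂ * D.K3 j ν y₂ x' := by
    simp only [kerW, if_neg hjne]
    rw [← mul_sub, ← Finset.sum_sub_distrib]
    congr 1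
    refine Finset.sum_congr rfl fun y₁ _ => ?_
    rw [← Finset.sum_sub_distrib]
    refine Finset.sum_congr rfl fun y₂ _ => ?_
    ring
  rw [hexp]
  obtain ⟨h1, h2, h3⟩ := hleaf.2 j hj1 hj
  have haj : D.a j ^ 2 ≤ ā ^ 2 := by
    calc D.a j ^ 2 = |D.a j| ^ 2 := (sq_abs _).symm
      _ ≤ ā ^ 2 := pow_le_pow_left₀ (abs_nonneg _) (ha j) 2
  have conv₁ := conv_two_mid (D.TU j) (D.dXU j) (D.dUU j) (L ^ (S.k - j) * D.distX x₁ x') x₁ x' δ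
    (3 / 4 * δ) (δ / 4) R R (by positivity) (by positivity) (by linarith) Rw.R_nonneg
    (G.dXU_nonneg j x₁) (G.dXU_nonneg j x') (G.dUU_nonneg j)
    (fun y₁ y₂ => G.tri j x₁ x' y₁ y₂ hj1 hj) (Rw.rowXU j x₁ hj1 hj) (fun y => Rw.rowUU j y hj1 hj)
  have conv₂ := conv_two_mid (D.TU j) (D.dXU j) (D.dUU j) (L ^ (S.k - j) * D.distX x₂ x') x₂ x' δ
    (3 / 4 * δ) (δ / 4) R R (by positivity) (by positivity) (by linarith) Rw.R_nonneg
    (G.dXU_nonneg j x₂) (G.dXU_nonneg j x') (G.dUU_nonneg j)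
    (fun y₁ y₂ => G.tri j x₂ x' y₁ y₂ hj1 hj) (Rw.rowXU j x₂ hj1 hj) (fun y => Rw.rowUU j y hj1 hj)
  have term : ∀ y₁ y₂, |(D.K1 j μ x₁ y₁ - D.K1 j μ x₂ y₁) * D.K2 j y₁ y₂ * D.K3 j ν y₂ x'| ≤
      c₁ * c₀ ^ 2 * (L ^ (S.k - j) * D.distX x₁ x₂) ^ α *
        (Real.exp (-(δ * D.dXU j x₁ y₁)) * Real.exp (-(δ * D.dUU j y₁ y₂)) *
            Real.exp (-(δ * D.dXU j x' y₂)) +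
          Real.exp (-(δ * D.dXU j x₂ y₁)) * Real.exp (-(δ * D.dUU j y₁ y₂)) *
            Real.exp (-(δ * D.dXU j x' y₂))) := by
    intro y₁ y₂
    rw [abs_mul, abs_mul]
    calc |D.K1 j μ x₁ y₁ - D.K1 j μ x₂ y₁| * |D.K2 j y₁ y₂| * |D.K3 j ν y₂ x'|
        ≤ (c₁ * (L ^ (S.k - j) * D.distX x₁ x₂) ^ α *
              (Real.exp (-(δ * D.dXU j x₁ y₁)) + Real.exp (-(δ * D.dXU j x₂ y₁)))) *
            (c₀ * Real.exp (-(δ * D.dUU j y₁ y₂))) * (c₀ * Real.exp (-(δ * D.dXU j x' y₂))) :=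
          mul_le_mul (mul_le_mul (h236 j hj1 hj μ x₁ x₂ y₁ hne) (h2 y₁ y₂) (abs_nonneg _) (by positivity))
            (h3 ν y₂ x') (abs_nonneg _) (by positivity)
      _ = c₁ * c₀ ^ 2 * (L ^ (S.k - j) * D.distX x₁ x₂) ^ α *
            (Real.exp (-(δ * D.dXU j x₁ y₁)) * Real.exp (-(δ * D.dUU j y₁ y₂)) *
                Real.exp (-(δ * D.dXU j x' y₂)) +
              Real.exp (-(δ * D.dXU j x₂ y₁)) * Real.exp (-(δ * D.dUU j y₁ y₂)) *
                Real.exp (-(δ * D.dXU j x' y₂))) := by ring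
  have hre : ∑ y₁ ∈ D.TU j, ∑ y₂ ∈ D.TU j, c₁ * c₀ ^ 2 * (L ^ (S.k - j) * D.distX x₁ x₂) ^ α *
        (Real.exp (-(δ * D.dXU j x₁ y₁)) * Real.exp (-(δ * D.dUU j y₁ y₂)) *
            Real.exp (-(δ * D.dXU j x' y₂)) +
          Real.exp (-(δ * D.dXU j x₂ y₁)) * Real.exp (-(δ * D.dUU j y₁ y₂)) *
            Real.exp (-(δ * D.dXU j x' y₂))) =
      c₁ * c₀ ^ 2 * (L ^ (S.k - j) * D.distX x₁ x₂) ^ α *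
        (∑ y₁ ∈ D.TU j, ∑ y₂ ∈ D.TU j, Real.exp (-(δ * D.dXU j x₁ y₁)) *
            Real.exp (-(δ * D.dUU j y₁ y₂)) * Real.exp (-(δ * D.dXU j x' y₂)) +
          ∑ y₁ ∈ D.TU j, ∑ y₂ ∈ D.TU j, Real.exp (-(δ * D.dXU j x₂ y₁)) *
            Real.exp (-(δ * D.dUU j y₁ y₂)) * Real.exp (-(δ * D.dXU j x' y₂))) := by
    rw [← Finset.sum_add_distrib, Finset.mul_sum]
    refine Finset.sum_congr rfl fun y₁ _ => ?_
    rw [← Finset.sum_add_distrib, Finset.mul_sum]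
  calc |D.a j ^ 2 * ∑ y₁ ∈ D.TU j, ∑ y₂ ∈ D.TU j,
          (D.K1 j μ x₁ y₁ - D.K1 j μ x₂ y₁) * D.K2 j y₁ y₂ * D.K3 j ν y₂ x'|
      = D.a j ^ 2 * |∑ y₁ ∈ D.TU j, ∑ y₂ ∈ D.TU j,
          (D.K1 j μ x₁ y₁ - D.K1 j μ x₂ y₁) * D.K2 j y₁ y₂ * D.K3 j ν y₂ x'| := by
        rw [abs_mul, abs_of_nonneg (sq_nonneg _)]
    _ ≤ ā ^ 2 * ∑ y₁ ∈ D.TU j, ∑ y₂ ∈ D.TU j,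
          |(D.K1 j μ x₁ y₁ - D.K1 j μ x₂ y₁) * D.K2 j y₁ y₂ * D.K3 j ν y₂ x'| := by
        refine mul_le_mul haj ?_ (abs_nonneg _) (by positivity)
        exact (Finset.abs_sum_le_sum_abs _ _).trans
          (Finset.sum_le_sum fun y₁ _ => Finset.abs_sum_le_sum_abs _ _)
    _ ≤ ā ^ 2 * ∑ y₁ ∈ D.TU j, ∑ y₂ ∈ D.TU j, c₁ * c₀ ^ 2 * (L ^ (S.k - j) * D.distX x₁ x₂) ^ α *
          (Real.exp (-(δ * D.dXU j x₁ y₁)) * Real.exp (-(δ * D.dUU j y₁ y₂)) *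
              Real.exp (-(δ * D.dXU j x' y₂)) +
            Real.exp (-(δ * D.dXU j x₂ y₁)) * Real.exp (-(δ * D.dUU j y₁ y₂)) *
              Real.exp (-(δ * D.dXU j x' y₂))) :=
        mul_le_mul_of_nonneg_left
          (Finset.sum_le_sum fun y₁ _ => Finset.sum_le_sum fun y₂ _ => term y₁ y₂) (by positivity)
    _ = ā ^ 2 * (c₁ * c₀ ^ 2 * (L ^ (S.k - j) * D.distX x₁ x₂) ^ α *
          (∑ y₁ ∈ D.TU j, ∑ y₂ ∈ D.TU j, Real.exp (-(δ * D.dXU j x₁ y₁)) *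
              Real.exp (-(δ * D.dUU j y₁ y₂)) * Real.exp (-(δ * D.dXU j x' y₂)) +
            ∑ y₁ ∈ D.TU j, ∑ y₂ ∈ D.TU j, Real.exp (-(δ * D.dXU j x₂ y₁)) *
              Real.exp (-(δ * D.dUU j y₁ y₂)) * Real.exp (-(δ * D.dXU j x' y₂)))) := by
        rw [hre]
    _ ≤ ā ^ 2 * (c₁ * c₀ ^ 2 * (L ^ (S.k - j) * D.distX x₁ x₂) ^ α *
          (R * R * Real.exp (-(3 / 4 * δ * (L ^ (S.k - j) * D.distX x₁ x'))) +
            R * R * Real.exp (-(3 / 4 * δ * (L ^ (S.k - j) * D.distX x₂ x'))))) :=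
        mul_le_mul_of_nonneg_left (mul_le_mul_of_nonneg_left (add_le_add conv₁ conv₂) (by positivity))
          (by positivity)
    _ = ā ^ 2 * c₁ * c₀ ^ 2 * R ^ 2 * (L ^ (S.k - j) * D.distX x₁ x₂) ^ α *
          (Real.exp (-(3 / 4 * δ * (L ^ (S.k - j) * D.distX x₁ x'))) +
            Real.exp (-(3 / 4 * δ * (L ^ (S.k - j) * D.distX x₂ x')))) := by ring



/-! ## §4. Kernel-checked: (1.136) + ∂*_ν1 = 0 + (2.35)–(2.37) ⟹ the difference estimate, rate ½δ′₀ -/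

/-- **Crude regime, one scale** j with L^{k−j}|x₁ − x₂| ≥ 1: |T_j(x₁) − T_j(x₂)| ≤ |T_j(x₁)| + |T_j(x₂)|, each
bounded by (1.137)'s per-scale estimate `termT_abs_le` at exponent α + ε, and (L^jη)^{α+ε} ≤ |x₁ − x₂|^α(L^jη)^ε
(`scale_pow_crude_le`). [cite: Balaban1984PropagatorsI, (1.136)–(1.137) pp.39–40] -/
theorem termT_diff_crude_le (D : ScaleData S) (L : ℝ) (d : ℕ) (c₀ δ cc c' t ā R Λ α ε : ℝ) (hL : 1 < L)
    (hc₀ : 0 ≤ c₀) (hδ : 0 ≤ δ) (hα : 0 ≤ α) (hε : 0 < ε) (he1 : α + ε ≤ 1) (ha : ∀ j, |D.a j| ≤ ā)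
    (hleaf : Leaf235to237 D L c₀ δ) (G : Geometry D L cc) (Rw : RowSums D L d (δ / 4) R Λ) (N : NormFacts D)
    {j : ℕ} (hj : j < S.k) (μ ν : D.Dir) (f : D.F) (x₁ x₂ : D.X) (hx₁ : x₁ ∈ D.TX) (hx₂ : x₂ ∈ D.TX)
    (hcrude : 1 ≤ L ^ (S.k - j) * D.distX x₁ x₂)
    (hsep1 : ∀ x' ∈ D.TX, D.eval f x' - D.eval f x₁ ≠ 0 → t - c' ≤ D.distX x₁ x')
    (hsep2 : ∀ x' ∈ D.TX, D.eval f x' - D.eval f x₂ ≠ 0 → t - c' ≤ D.distX x₂ x') :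
    |termT D L d j μ ν f x₁ - termT D L d j μ ν f x₂| ≤
      2 * (c₀ + ā ^ 2 * c₀ ^ 3 * R ^ 2) * (Real.exp (δ / 2 * c') * Real.exp (-(δ / 2 * t))) *
        (D.holderF (α + ε) f + 2 * D.supF f) * Λ * (D.distX x₁ x₂ ^ α * (L ^ ((j : ℝ) - S.k)) ^ ε) := by
  have hL0 : 0 < L := lt_trans zero_lt_one hL
  have he0 : 0 < α + ε := by linarith
  have hs0 : 0 < L ^ ((j : ℝ) - S.k) := Real.rpow_pos_of_pos hL0 _
  have hsN : L ^ ((j : ℝ) - S.k) * L ^ (S.k - j) = 1 := scale_cancel hL0 hj.le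
  have hH0 : 0 ≤ D.holderF (α + ε) f := N.holder_nonneg _ f
  have hM0 : 0 ≤ D.supF f := N.sup_nonneg f
  have hΛ0 : 0 ≤ Λ := Rw.Λ_nonneg
  have hsρ : L ^ ((j : ℝ) - S.k) ≤ D.distX x₁ x₂ := by
    have := mul_le_mul_of_nonneg_left hcrude hs0.le
    rwa [mul_one, ← mul_assoc, hsN, one_mul] at this
  have hF3 := scale_pow_crude_le (ε := ε) hs0 hα hsρ
  have h1 := termT_abs_le D L d c₀ δ cc c' t ā R Λ (α + ε) hL hc₀ hδ he0 he1 ha hleaf G Rw N hj μ ν f x₁ hx₁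
    hsep1
  have h2 := termT_abs_le D L d c₀ δ cc c' t ā R Λ (α + ε) hL hc₀ hδ he0 he1 ha hleaf G Rw N hj μ ν f x₂ hx₂
    hsep2
  calc |termT D L d j μ ν f x₁ - termT D L d j μ ν f x₂|
      ≤ |termT D L d j μ ν f x₁| + |termT D L d j μ ν f x₂| := abs_sub _ _
    _ ≤ (c₀ + ā ^ 2 * c₀ ^ 3 * R ^ 2) * (Real.exp (δ / 2 * c') * Real.exp (-(δ / 2 * t)) *
            (D.holderF (α + ε) f + 2 * D.supF f) * Λ * (L ^ ((j : ℝ) - S.k)) ^ (α + ε)) +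
          (c₀ + ā ^ 2 * c₀ ^ 3 * R ^ 2) * (Real.exp (δ / 2 * c') * Real.exp (-(δ / 2 * t)) *
            (D.holderF (α + ε) f + 2 * D.supF f) * Λ * (L ^ ((j : ℝ) - S.k)) ^ (α + ε)) :=
        add_le_add h1 h2
    _ = 2 * (c₀ + ā ^ 2 * c₀ ^ 3 * R ^ 2) * (Real.exp (δ / 2 * c') * Real.exp (-(δ / 2 * t))) *
          (D.holderF (α + ε) f + 2 * D.supF f) * Λ * (L ^ ((j : ℝ) - S.k)) ^ (α + ε) := by ring
    _ ≤ 2 * (c₀ + ā ^ 2 * c₀ ^ 3 * R ^ 2) * (Real.exp (δ / 2 * c') * Real.exp (-(δ / 2 * t))) *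
          (D.holderF (α + ε) f + 2 * D.supF f) * Λ * (D.distX x₁ x₂ ^ α * (L ^ ((j : ℝ) - S.k)) ^ ε) :=
        mul_le_mul_of_nonneg_left hF3 (by positivity)

/-- **Hölder regime, one scale** 1 ≤ j with L^{k−j}|x₁ − x₂| ≤ 1: by ∂*_ν1 = 0 (`termT_sub`) and the kernel
Hölder bound (2.36) ⊗ (2.35)/(2.37) (`kerW_holder`), |T_j(x₁) − T_j(x₂)| ≤ ā²c₁c₀²R²(L^{k−j}ρ)^α[S₁ + S₂] with
S₁ = Σ_{x′}L^{−jd}e^{−(3/4)δD̃₁}|f(x′) − f(x₁)| (`center_sum_le` at x₁) and S₂ = Σ_{x′}L^{−jd}e^{−(3/4)δD̃₂}|f(x′)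
− f(x₁)| ≤ Σ(…)|f(x′) − f(x₂)| + (Σ(…))|f(x₂) − f(x₁)| (`center_sum_le` at x₂; |f(x₂) − f(x₁)| ≤
‖f‖_{α+ε}ρ^{α+ε} by (1.109), the bare weight sum ≤ e^{(1/2)δc′}e^{−(1/2)δt}Λ); then (L^{k−j}ρ)^α(L^jη)^{α+ε} =
ρ^α(L^jη)^ε and (L^{k−j}ρ)^αρ^{α+ε} ≤ ρ^α(L^jη)^ε. [cite: Balaban1984PropagatorsI, (1.136) p.39; Balaban1983RegularityDecay, (2.35)–(2.37) p.582] -/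
theorem termT_diff_fine_le (D : ScaleData S) (L : ℝ) (d : ℕ) (c₀ c₁ δ cc c' t ā R Λ α ε : ℝ) (hL : 1 < L)
    (hc₀ : 0 ≤ c₀) (hc₁ : 0 ≤ c₁) (hδ : 0 ≤ δ) (hα : 0 ≤ α) (hε : 0 < ε) (he1 : α + ε ≤ 1)
    (ha : ∀ j, |D.a j| ≤ ā) (Z : RowZero D) (hleaf : Leaf235to237 D L c₀ δ) (h236 : Leaf236 D L α c₁ δ)
    (G : Geometry D L cc) (Rw : RowSums D L d (δ / 4) R Λ) (N : NormFacts D)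
    {j : ℕ} (hj1 : 1 ≤ j) (hj : j < S.k) (μ ν : D.Dir) (f : D.F) (x₁ x₂ : D.X) (hx₁ : x₁ ∈ D.TX)
    (hx₂ : x₂ ∈ D.TX) (hne : x₁ ≠ x₂) (hρ1 : D.distX x₁ x₂ ≤ 1) (hfine : L ^ (S.k - j) * D.distX x₁ x₂ ≤ 1)
    (hsep1 : ∀ x' ∈ D.TX, D.eval f x' - D.eval f x₁ ≠ 0 → t - c' ≤ D.distX x₁ x')
    (hsep2 : ∀ x' ∈ D.TX, D.eval f x' - D.eval f x₂ ≠ 0 → t - c' ≤ D.distX x₂ x')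
    (hsep12 : D.eval f x₂ - D.eval f x₁ ≠ 0 → t - c' ≤ 0) :
    |termT D L d j μ ν f x₁ - termT D L d j μ ν f x₂| ≤
      ā ^ 2 * c₁ * c₀ ^ 2 * R ^ 2 * (Real.exp (δ / 2 * c') * Real.exp (-(δ / 2 * t))) *
        (3 * D.holderF (α + ε) f + 4 * D.supF f) * Λ * (D.distX x₁ x₂ ^ α * (L ^ ((j : ℝ) - S.k)) ^ ε) := by
  have hL0 : 0 < L := lt_trans zero_lt_one hL
  have hL1 : 1 ≤ L := hL.le
  have he0 : 0 < α + ε := by linarith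
  have hρ0 : 0 ≤ D.distX x₁ x₂ := G.distX_nonneg x₁ x₂
  have hs0 : 0 < L ^ ((j : ℝ) - S.k) := Real.rpow_pos_of_pos hL0 _
  have hN0 : 0 ≤ L ^ (S.k - j) := pow_nonneg hL0.le _
  have hsN : L ^ ((j : ℝ) - S.k) * L ^ (S.k - j) = 1 := scale_cancel hL0 hj.le
  have hH0 : 0 ≤ D.holderF (α + ε) f := N.holder_nonneg _ f
  have hM0 : 0 ≤ D.supF f := N.sup_nonneg f
  have hΛ0 : 0 ≤ Λ := Rw.Λ_nonneg
  obtain ⟨B, hB⟩ : ∃ B : ℝ, B = Real.exp (δ / 2 * c') * Real.exp (-(δ / 2 * t)) := ⟨_, rfl⟩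
  have hB0 : 0 ≤ B := by rw [hB]; positivity
  rw [← hB]
  have hF1 := scale_pow_fine_eq (α := α) (ε := ε) hs0 hN0 hρ0 hsN
  have hF2 := scale_pow_fine_le hs0 hN0 hρ0 hsN hα hε hfine
  have P1 := center_sum_le D L d δ cc c' t R Λ (α + ε) hL hδ he0 he1 G Rw N hj f x₁ hx₁ hsep1
  have P2 := center_sum_le D L d δ cc c' t R Λ (α + ε) hL hδ he0 he1 G Rw N hj f x₂ hx₂ hsep2
  rw [← hB] at P1 P2
  have hfx : |D.eval f x₂ - D.eval f x₁| ≤ D.holderF (α + ε) f * D.distX x₁ x₂ ^ (α + ε) :=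
    N.holder_le (α + ε) f x₁ x₂ he0 hρ1
  have hρe : 0 ≤ D.distX x₁ x₂ ^ (α + ε) := Real.rpow_nonneg hρ0 _
  -- the bare weight sum at x₂ times |f(x₂) − f(x₁)|
  have P3 : (∑ x' ∈ D.TX, (L ^ (j * d))⁻¹ *
        Real.exp (-(3 / 4 * δ * (L ^ (S.k - j) * D.distX x₂ x')))) * |D.eval f x₂ - D.eval f x₁| ≤
      B * Λ * (D.holderF (α + ε) f * D.distX x₁ x₂ ^ (α + ε)) := by
    by_cases hz : D.eval f x₂ - D.eval f x₁ = 0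
    · rw [hz, abs_zero, mul_zero]
      positivity
    · have ht0 : t - c' ≤ 0 := hsep12 hz
      have hsum : ∑ x' ∈ D.TX, (L ^ (j * d))⁻¹ *
          Real.exp (-(3 / 4 * δ * (L ^ (S.k - j) * D.distX x₂ x'))) ≤ B * Λ := by
        calc ∑ x' ∈ D.TX, (L ^ (j * d))⁻¹ * Real.exp (-(3 / 4 * δ * (L ^ (S.k - j) * D.distX x₂ x')))
            ≤ ∑ x' ∈ D.TX, B * ((L ^ (j * d))⁻¹ *
                (Real.exp (-(δ / 4 * (L ^ (S.k - j) * D.distX x₂ x'))) *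
                  (1 + L ^ (S.k - j) * D.distX x₂ x'))) := by
              refine Finset.sum_le_sum fun x' _ => ?_
              have hdX : 0 ≤ D.distX x₂ x' := G.distX_nonneg _ _
              have hDt0 : 0 ≤ L ^ (S.k - j) * D.distX x₂ x' := mul_nonneg hN0 hdX
              have hLjd : 0 < (L ^ (j * d))⁻¹ := inv_pos.mpr (pow_pos hL0 _)
              have hsplit := exp_three_quarter_split hδ (ht0.trans hDt0)
              rw [← hB] at hsplit
              have hgrow : Real.exp (-(δ / 4 * (L ^ (S.k - j) * D.distX x₂ x'))) ≤
                  Real.exp (-(δ / 4 * (L ^ (S.k - j) * D.distX x₂ x'))) * (1 + L ^ (S.k - j) * D.distX x₂ x') :=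
                le_mul_of_one_le_right (Real.exp_nonneg _) (by linarith)
              calc (L ^ (j * d))⁻¹ * Real.exp (-(3 / 4 * δ * (L ^ (S.k - j) * D.distX x₂ x')))
                  ≤ (L ^ (j * d))⁻¹ * (B * Real.exp (-(δ / 4 * (L ^ (S.k - j) * D.distX x₂ x')))) :=
                    mul_le_mul_of_nonneg_left hsplit hLjd.le
                _ ≤ (L ^ (j * d))⁻¹ * (B * (Real.exp (-(δ / 4 * (L ^ (S.k - j) * D.distX x₂ x'))) *
                      (1 + L ^ (S.k - j) * D.distX x₂ x'))) :=
                    mul_le_mul_of_nonneg_left (mul_le_mul_of_nonneg_left hgrow hB0) hLjd.le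
                _ = B * ((L ^ (j * d))⁻¹ * (Real.exp (-(δ / 4 * (L ^ (S.k - j) * D.distX x₂ x'))) *
                      (1 + L ^ (S.k - j) * D.distX x₂ x'))) := by ring
          _ = B * ∑ x' ∈ D.TX, ((L ^ (j * d))⁻¹ *
                (Real.exp (-(δ / 4 * (L ^ (S.k - j) * D.distX x₂ x'))) *
                  (1 + L ^ (S.k - j) * D.distX x₂ x'))) := by rw [Finset.mul_sum]
          _ ≤ B * Λ := mul_le_mul_of_nonneg_left (Rw.lat j x₂ hj hx₂) hB0
      exact mul_le_mul hsum hfx (abs_nonneg _) (by positivity)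
  have hW : ∀ x' : D.X, |kerW D j μ ν x₁ x' - kerW D j μ ν x₂ x'| ≤
      ā ^ 2 * c₁ * c₀ ^ 2 * R ^ 2 * (L ^ (S.k - j) * D.distX x₁ x₂) ^ α *
        (Real.exp (-(3 / 4 * δ * (L ^ (S.k - j) * D.distX x₁ x'))) +
          Real.exp (-(3 / 4 * δ * (L ^ (S.k - j) * D.distX x₂ x')))) := fun x' =>
    kerW_holder D L c₀ c₁ δ cc ā R Λ α d hL1 hc₀ hc₁ hδ ha hleaf h236 G Rw hj1 hj μ ν x₁ x₂ x' hne
  have hP0 : 0 ≤ (L ^ (S.k - j) * D.distX x₁ x₂) ^ α := Real.rpow_nonneg (mul_nonneg hN0 hρ0) _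
  rw [termT_sub D L d Z hj μ ν f x₁ x₂ hx₂]
  calc |∑ x' ∈ D.TX, (L ^ (j * d))⁻¹ * (kerW D j μ ν x₁ x' - kerW D j μ ν x₂ x') *
          (D.eval f x' - D.eval f x₁)|
      ≤ ∑ x' ∈ D.TX, |(L ^ (j * d))⁻¹ * (kerW D j μ ν x₁ x' - kerW D j μ ν x₂ x') *
          (D.eval f x' - D.eval f x₁)| := Finset.abs_sum_le_sum_abs _ _
    _ ≤ ∑ x' ∈ D.TX, (L ^ (j * d))⁻¹ * (ā ^ 2 * c₁ * c₀ ^ 2 * R ^ 2 *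
          (L ^ (S.k - j) * D.distX x₁ x₂) ^ α *
          (Real.exp (-(3 / 4 * δ * (L ^ (S.k - j) * D.distX x₁ x'))) +
            Real.exp (-(3 / 4 * δ * (L ^ (S.k - j) * D.distX x₂ x'))))) *
          |D.eval f x' - D.eval f x₁| := by
        refine Finset.sum_le_sum fun x' _ => ?_
        have hLjd : 0 < (L ^ (j * d))⁻¹ := inv_pos.mpr (pow_pos hL0 _)
        rw [abs_mul, abs_mul, abs_of_pos hLjd]
        exact mul_le_mul_of_nonneg_right (mul_le_mul_of_nonneg_left (hW x') hLjd.le) (abs_nonneg _)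
    _ = ā ^ 2 * c₁ * c₀ ^ 2 * R ^ 2 * (L ^ (S.k - j) * D.distX x₁ x₂) ^ α *
          (∑ x' ∈ D.TX, (L ^ (j * d))⁻¹ *
              Real.exp (-(3 / 4 * δ * (L ^ (S.k - j) * D.distX x₁ x'))) * |D.eval f x' - D.eval f x₁| +
            ∑ x' ∈ D.TX, (L ^ (j * d))⁻¹ *
              Real.exp (-(3 / 4 * δ * (L ^ (S.k - j) * D.distX x₂ x'))) * |D.eval f x' - D.eval f x₁|) := by
        rw [← Finset.sum_add_distrib, Finset.mul_sum]
        refine Finset.sum_congr rfl fun x' _ => ?_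
        ring
    _ ≤ ā ^ 2 * c₁ * c₀ ^ 2 * R ^ 2 * (L ^ (S.k - j) * D.distX x₁ x₂) ^ α *
          (∑ x' ∈ D.TX, (L ^ (j * d))⁻¹ *
              Real.exp (-(3 / 4 * δ * (L ^ (S.k - j) * D.distX x₁ x'))) * |D.eval f x' - D.eval f x₁| +
            (∑ x' ∈ D.TX, (L ^ (j * d))⁻¹ *
                Real.exp (-(3 / 4 * δ * (L ^ (S.k - j) * D.distX x₂ x'))) * |D.eval f x' - D.eval f x₂| +
              (∑ x' ∈ D.TX, (L ^ (j * d))⁻¹ *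
                Real.exp (-(3 / 4 * δ * (L ^ (S.k - j) * D.distX x₂ x')))) *
                |D.eval f x₂ - D.eval f x₁|)) := by
        refine mul_le_mul_of_nonneg_left (add_le_add le_rfl ?_) (by positivity)
        rw [Finset.sum_mul, ← Finset.sum_add_distrib]
        refine Finset.sum_le_sum fun x' _ => ?_
        have hw : 0 ≤ (L ^ (j * d))⁻¹ * Real.exp (-(3 / 4 * δ * (L ^ (S.k - j) * D.distX x₂ x'))) :=
          mul_nonneg (inv_nonneg.mpr (pow_nonneg hL0.le _)) (Real.exp_nonneg _)
        calc (L ^ (j * d))⁻¹ * Real.exp (-(3 / 4 * δ * (L ^ (S.k - j) * D.distX x₂ x'))) *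
              |D.eval f x' - D.eval f x₁|
            ≤ (L ^ (j * d))⁻¹ * Real.exp (-(3 / 4 * δ * (L ^ (S.k - j) * D.distX x₂ x'))) *
                (|D.eval f x' - D.eval f x₂| + |D.eval f x₂ - D.eval f x₁|) :=
              mul_le_mul_of_nonneg_left (abs_sub_le _ _ _) hw
          _ = (L ^ (j * d))⁻¹ * Real.exp (-(3 / 4 * δ * (L ^ (S.k - j) * D.distX x₂ x'))) *
                |D.eval f x' - D.eval f x₂| +
              (L ^ (j * d))⁻¹ * Real.exp (-(3 / 4 * δ * (L ^ (S.k - j) * D.distX x₂ x'))) *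
                |D.eval f x₂ - D.eval f x₁| := mul_add _ _ _
    _ ≤ ā ^ 2 * c₁ * c₀ ^ 2 * R ^ 2 * (L ^ (S.k - j) * D.distX x₁ x₂) ^ α *
          (B * (D.holderF (α + ε) f + 2 * D.supF f) * Λ * (L ^ ((j : ℝ) - S.k)) ^ (α + ε) +
            (B * (D.holderF (α + ε) f + 2 * D.supF f) * Λ * (L ^ ((j : ℝ) - S.k)) ^ (α + ε) +
              B * Λ * (D.holderF (α + ε) f * D.distX x₁ x₂ ^ (α + ε)))) :=
        mul_le_mul_of_nonneg_left (add_le_add P1 (add_le_add P2 P3)) (by positivity)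
    _ = ā ^ 2 * c₁ * c₀ ^ 2 * R ^ 2 * B * Λ *
          (2 * (D.holderF (α + ε) f + 2 * D.supF f) *
              ((L ^ (S.k - j) * D.distX x₁ x₂) ^ α * (L ^ ((j : ℝ) - S.k)) ^ (α + ε)) +
            D.holderF (α + ε) f * ((L ^ (S.k - j) * D.distX x₁ x₂) ^ α * D.distX x₁ x₂ ^ (α + ε))) := by
        ring
    _ ≤ ā ^ 2 * c₁ * c₀ ^ 2 * R ^ 2 * B * Λ *
          (2 * (D.holderF (α + ε) f + 2 * D.supF f) * (D.distX x₁ x₂ ^ α * (L ^ ((j : ℝ) - S.k)) ^ ε) +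
            D.holderF (α + ε) f * (D.distX x₁ x₂ ^ α * (L ^ ((j : ℝ) - S.k)) ^ ε)) := by
        rw [hF1]
        exact mul_le_mul_of_nonneg_left (add_le_add le_rfl (mul_le_mul_of_nonneg_left hF2 hH0)) (by positivity)
    _ = ā ^ 2 * c₁ * c₀ ^ 2 * R ^ 2 * B * (3 * D.holderF (α + ε) f + 4 * D.supF f) * Λ *
          (D.distX x₁ x₂ ^ α * (L ^ ((j : ℝ) - S.k)) ^ ε) := by ring

/-- **The difference estimate behind (1.113), kernel-checked from (1.136), ∂*_ν1 = 0 and the estimates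
(2.35)–(2.37)** — our reading of *"The proof of (1.113) is similar"* (p. 40), every inequality sign explicit: by
(1.136), (∂_μG′_k∂*_νf)(x₁) − (∂_μG′_k∂*_νf)(x₂) = Σ_{j=0}^{k−1}(T_j(x₁) − T_j(x₂)); the support bookkeeping (x₁ ∈
Δ̃(y), |x₁ − x₂| ≤ 1, supp f ⊂ Δ̃(y′): a non-zero f(x′) − f(x_i) forces |y − y′| − (c + 1) ≤ |x_i − x′|); a scale
with L^{k−j}|x₁ − x₂| ≥ 1 is `termT_diff_crude_le`, a scale with L^{k−j}|x₁ − x₂| < 1 (then j ≥ 1, since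
|x₁ − x₂| ≥ η: `Geometry113.lattice_sep`) is `termT_diff_fine_le`; both are ≤ Φ·|x₁ − x₂|^α(L^jη)^ε with
Φ = (2(c₀ + ā²c₀³R²) + ā²c₁c₀²R²)e^{(1/2)δ′₀(c+1)}e^{−(1/2)δ′₀|y−y′|}(3‖f‖_{α+ε} + 4|f|)Λ, and the scale sum
Σ_j(L^jη)^ε ≤ 1/(L^ε − 1) (`B5FromB4.scale_sum_bound`, the printed "O(1) → ∞ if ε → 0") finishes.  The sup half is
(1.137)'s per-scale bound at x₂ with exponent α + ε and 1/(L^{α+ε} − 1) ≤ 1/(L^ε − 1).  Result: rate ½δ′₀ and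
O(1) = 4(2(c₀ + ā²c₀³R²) + ā²c₁c₀²R²)e^{(1/2)δ′₀(c+1)}Λ/(L^ε − 1). [cite: Balaban1984PropagatorsI, (1.113) p.36, (1.135)–(1.137) pp.39–40] -/
theorem ineq113At_of_display136 (D : ScaleData S) (L : ℝ) (d : ℕ) (c₀ c₁ δ₀' cc ā R Λ α : ℝ) (hL : 1 < L)
    (hc₀ : 0 ≤ c₀) (hc₁ : 0 ≤ c₁) (hδ : 0 < δ₀') (hα : 0 ≤ α) (ha : ∀ j, |D.a j| ≤ ā)
    (h136 : Display136 D L d) (Z : RowZero D) (hleaf : Leaf235to237 D L c₀ δ₀')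
    (h236 : Leaf236 D L α c₁ δ₀') (G : Geometry D L cc) (G' : Geometry113 D L)
    (Rw : RowSums D L d (δ₀' / 4) R Λ) (N : NormFacts D) :
    Ineq113At D α (fun ε => 4 * ((2 * (c₀ + ā ^ 2 * c₀ ^ 3 * R ^ 2) + ā ^ 2 * c₁ * c₀ ^ 2 * R ^ 2) *
      Real.exp (δ₀' / 2 * (cc + 1)) * Λ) / (L ^ ε - 1)) (δ₀' / 2) := by
  intro ε μ ν f x₁ x₂ y y' hε0 hαε hx₁ hx₂ hne hρ1 hcube hsupp
  show |D.E μ ν f x₁ - D.E μ ν f x₂| ≤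
      4 * ((2 * (c₀ + ā ^ 2 * c₀ ^ 3 * R ^ 2) + ā ^ 2 * c₁ * c₀ ^ 2 * R ^ 2) *
        Real.exp (δ₀' / 2 * (cc + 1)) * Λ) / (L ^ ε - 1) * Real.exp (-(δ₀' / 2 * S.dist y y')) *
        (D.holderF (α + ε) f + D.supF f) * D.distX x₁ x₂ ^ α ∧
    |D.E μ ν f x₂| ≤
      4 * ((2 * (c₀ + ā ^ 2 * c₀ ^ 3 * R ^ 2) + ā ^ 2 * c₁ * c₀ ^ 2 * R ^ 2) *
        Real.exp (δ₀' / 2 * (cc + 1)) * Λ) / (L ^ ε - 1) * Real.exp (-(δ₀' / 2 * S.dist y y')) *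
        (D.holderF (α + ε) f + D.supF f)
  have hL0 : 0 < L := lt_trans zero_lt_one hL
  have he0 : 0 < α + ε := by linarith
  have he1 : α + ε ≤ 1 := hαε.le
  have hρ0 : 0 ≤ D.distX x₁ x₂ := G.distX_nonneg x₁ x₂
  have hH0 : 0 ≤ D.holderF (α + ε) f := N.holder_nonneg _ f
  have hM0 : 0 ≤ D.supF f := N.sup_nonneg f
  have hΛ0 : 0 ≤ Λ := Rw.Λ_nonneg
  have hCW0 : 0 ≤ c₀ + ā ^ 2 * c₀ ^ 3 * R ^ 2 := by positivity
  have hCH0 : 0 ≤ ā ^ 2 * c₁ * c₀ ^ 2 * R ^ 2 := by positivity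
  have hρα : 0 ≤ D.distX x₁ x₂ ^ α := Real.rpow_nonneg hρ0 _
  have hLε : 0 < L ^ ε - 1 := by
    have := Real.one_lt_rpow hL hε0
    linarith
  have hinv0 : 0 ≤ 1 / (L ^ ε - 1) := (one_div_pos.mpr hLε).le
  obtain ⟨B, hB⟩ : ∃ B : ℝ, B = Real.exp (δ₀' / 2 * (cc + 1)) * Real.exp (-(δ₀' / 2 * S.dist y y')) :=
    ⟨_, rfl⟩
  have hB0 : 0 ≤ B := by rw [hB]; positivity
  obtain ⟨Φ, hΦ⟩ : ∃ Φ : ℝ, Φ = (2 * (c₀ + ā ^ 2 * c₀ ^ 3 * R ^ 2) + ā ^ 2 * c₁ * c₀ ^ 2 * R ^ 2) * B *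
      (3 * D.holderF (α + ε) f + 4 * D.supF f) * Λ := ⟨_, rfl⟩
  have hΦ0 : 0 ≤ Φ := by rw [hΦ]; positivity
  -- support bookkeeping ("for x ∈ Δ̃(y), supp f ⊂ Δ̃(y′)") for the two centres x₁ ∈ Δ̃(y), |x₁ − x₂| ≤ 1
  have hsep1 : ∀ x' ∈ D.TX, D.eval f x' - D.eval f x₁ ≠ 0 → S.dist y y' - (cc + 1) ≤ D.distX x₁ x' := by
    intro x' _ hz
    by_cases hfx' : D.eval f x' = 0
    · have hfx : D.eval f x₁ ≠ 0 := fun h0 => hz (by rw [hfx', h0, sub_zero])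
      have := G.cube_near x₁ y y' hcube (hsupp x₁ hfx)
      linarith [G.distX_nonneg x₁ x']
    · have := G.cube_sep x₁ x' y y' hcube (hsupp x' hfx')
      linarith
  have hsep2 : ∀ x' ∈ D.TX, D.eval f x' - D.eval f x₂ ≠ 0 → S.dist y y' - (cc + 1) ≤ D.distX x₂ x' := by
    intro x' _ hz
    by_cases hfx' : D.eval f x' = 0
    · have hfx : D.eval f x₂ ≠ 0 := fun h0 => hz (by rw [hfx', h0, sub_zero])
      have := G.cube_sep x₁ x₂ y y' hcube (hsupp x₂ hfx)
      linarith [G.distX_nonneg x₂ x']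
    · have h1 := G.cube_sep x₁ x' y y' hcube (hsupp x' hfx')
      have h2 := G'.triX x₁ x₂ x'
      linarith
  have hsep12 : D.eval f x₂ - D.eval f x₁ ≠ 0 → S.dist y y' - (cc + 1) ≤ 0 := by
    intro hz
    by_cases hfx₂ : D.eval f x₂ = 0
    · have hfx : D.eval f x₁ ≠ 0 := fun h0 => hz (by rw [hfx₂, h0, sub_zero])
      have := G.cube_near x₁ y y' hcube (hsupp x₁ hfx)
      linarith
    · have := G.cube_sep x₁ x₂ y y' hcube (hsupp x₂ hfx₂)
      linarith
  -- per-scale bound of the difference, by regime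
  have key : ∀ j ∈ Finset.range S.k,
      |termT D L d j μ ν f x₁ - termT D L d j μ ν f x₂| ≤
        Φ * ((L ^ ((j : ℝ) - S.k)) ^ ε * D.distX x₁ x₂ ^ α) := by
    intro j hj
    have hjk : j < S.k := Finset.mem_range.mp hj
    have hsε : 0 ≤ (L ^ ((j : ℝ) - S.k)) ^ ε := Real.rpow_nonneg (Real.rpow_pos_of_pos hL0 _).le _
    rcases le_or_gt 1 (L ^ (S.k - j) * D.distX x₁ x₂) with hcrude | hfine
    · have h := termT_diff_crude_le D L d c₀ δ₀' cc (cc + 1) (S.dist y y') ā R Λ α ε hL hc₀ hδ.le hα hε0 he1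
        ha hleaf G Rw N hjk μ ν f x₁ x₂ hx₁ hx₂ hcrude hsep1 hsep2
      rw [← hB] at h
      refine h.trans ?_
      have hcoef : 2 * (c₀ + ā ^ 2 * c₀ ^ 3 * R ^ 2) * (D.holderF (α + ε) f + 2 * D.supF f) ≤
          (2 * (c₀ + ā ^ 2 * c₀ ^ 3 * R ^ 2) + ā ^ 2 * c₁ * c₀ ^ 2 * R ^ 2) *
            (3 * D.holderF (α + ε) f + 4 * D.supF f) :=
        mul_le_mul (by linarith) (by linarith) (by positivity) (by positivity)
      calc 2 * (c₀ + ā ^ 2 * c₀ ^ 3 * R ^ 2) * B * (D.holderF (α + ε) f + 2 * D.supF f) * Λ *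
            (D.distX x₁ x₂ ^ α * (L ^ ((j : ℝ) - S.k)) ^ ε)
          = 2 * (c₀ + ā ^ 2 * c₀ ^ 3 * R ^ 2) * (D.holderF (α + ε) f + 2 * D.supF f) *
              (B * Λ * (D.distX x₁ x₂ ^ α * (L ^ ((j : ℝ) - S.k)) ^ ε)) := by ring
        _ ≤ (2 * (c₀ + ā ^ 2 * c₀ ^ 3 * R ^ 2) + ā ^ 2 * c₁ * c₀ ^ 2 * R ^ 2) *
              (3 * D.holderF (α + ε) f + 4 * D.supF f) *
              (B * Λ * (D.distX x₁ x₂ ^ α * (L ^ ((j : ℝ) - S.k)) ^ ε)) :=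
            mul_le_mul_of_nonneg_right hcoef (by positivity)
        _ = Φ * ((L ^ ((j : ℝ) - S.k)) ^ ε * D.distX x₁ x₂ ^ α) := by rw [hΦ]; ring
    · have hj1 : 1 ≤ j := by
        rcases Nat.eq_zero_or_pos j with h0 | hpos
        · exfalso
          subst h0
          have := G'.lattice_sep x₁ x₂ hne
          rw [Nat.sub_zero] at hfine
          linarith
        · exact hpos
      have h := termT_diff_fine_le D L d c₀ c₁ δ₀' cc (cc + 1) (S.dist y y') ā R Λ α ε hL hc₀ hc₁ hδ.le hα
        hε0 he1 ha Z hleaf h236 G Rw N hj1 hjk μ ν f x₁ x₂ hx₁ hx₂ hne hρ1 hfine.le hsep1 hsep2 hsep12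
      rw [← hB] at h
      refine h.trans ?_
      calc ā ^ 2 * c₁ * c₀ ^ 2 * R ^ 2 * B * (3 * D.holderF (α + ε) f + 4 * D.supF f) * Λ *
            (D.distX x₁ x₂ ^ α * (L ^ ((j : ℝ) - S.k)) ^ ε)
          = ā ^ 2 * c₁ * c₀ ^ 2 * R ^ 2 * (B * (3 * D.holderF (α + ε) f + 4 * D.supF f) * Λ *
              (D.distX x₁ x₂ ^ α * (L ^ ((j : ℝ) - S.k)) ^ ε)) := by ring
        _ ≤ (2 * (c₀ + ā ^ 2 * c₀ ^ 3 * R ^ 2) + ā ^ 2 * c₁ * c₀ ^ 2 * R ^ 2) *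
              (B * (3 * D.holderF (α + ε) f + 4 * D.supF f) * Λ *
                (D.distX x₁ x₂ ^ α * (L ^ ((j : ℝ) - S.k)) ^ ε)) :=
            mul_le_mul_of_nonneg_right (by linarith) (by positivity)
        _ = Φ * ((L ^ ((j : ℝ) - S.k)) ^ ε * D.distX x₁ x₂ ^ α) := by rw [hΦ]; ring
  -- (1.136) at the two points and the scale sums
  have hE : D.E μ ν f x₁ - D.E μ ν f x₂ =
      ∑ j ∈ Finset.range S.k, (termT D L d j μ ν f x₁ - termT D L d j μ ν f x₂) := by
    simp only [termT]
    rw [Finset.sum_sub_distrib, h136 μ ν f x₁ hx₁, h136 μ ν f x₂ hx₂]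
  have hE₂ : D.E μ ν f x₂ = ∑ j ∈ Finset.range S.k, termT D L d j μ ν f x₂ := by
    simp only [termT]
    exact h136 μ ν f x₂ hx₂
  constructor
  · rw [hE]
    calc |∑ j ∈ Finset.range S.k, (termT D L d j μ ν f x₁ - termT D L d j μ ν f x₂)|
        ≤ ∑ j ∈ Finset.range S.k, |termT D L d j μ ν f x₁ - termT D L d j μ ν f x₂| :=
          Finset.abs_sum_le_sum_abs _ _
      _ ≤ ∑ j ∈ Finset.range S.k, Φ * ((L ^ ((j : ℝ) - S.k)) ^ ε * D.distX x₁ x₂ ^ α) :=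
          Finset.sum_le_sum key
      _ = Φ * D.distX x₁ x₂ ^ α * ∑ j ∈ Finset.range S.k, (L ^ ((j : ℝ) - S.k)) ^ ε := by
          rw [Finset.mul_sum]
          exact Finset.sum_congr rfl fun j _ => by ring
      _ ≤ Φ * D.distX x₁ x₂ ^ α * (1 / (L ^ ε - 1)) :=
          mul_le_mul_of_nonneg_left (B5FromB4.scale_sum_bound L ε hL hε0 S.k) (mul_nonneg hΦ0 hρα)
      _ = (2 * (c₀ + ā ^ 2 * c₀ ^ 3 * R ^ 2) + ā ^ 2 * c₁ * c₀ ^ 2 * R ^ 2) *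
            Real.exp (δ₀' / 2 * (cc + 1)) * Λ * (1 / (L ^ ε - 1)) * Real.exp (-(δ₀' / 2 * S.dist y y')) *
            (3 * D.holderF (α + ε) f + 4 * D.supF f) * D.distX x₁ x₂ ^ α := by
          rw [hΦ, hB]; ring
      _ ≤ (2 * (c₀ + ā ^ 2 * c₀ ^ 3 * R ^ 2) + ā ^ 2 * c₁ * c₀ ^ 2 * R ^ 2) *
            Real.exp (δ₀' / 2 * (cc + 1)) * Λ * (1 / (L ^ ε - 1)) * Real.exp (-(δ₀' / 2 * S.dist y y')) *
            (4 * (D.holderF (α + ε) f + D.supF f)) * D.distX x₁ x₂ ^ α := by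
          refine mul_le_mul_of_nonneg_right (mul_le_mul_of_nonneg_left (by linarith) ?_) hρα
          exact mul_nonneg (mul_nonneg (by positivity) hinv0) (Real.exp_nonneg _)
      _ = 4 * ((2 * (c₀ + ā ^ 2 * c₀ ^ 3 * R ^ 2) + ā ^ 2 * c₁ * c₀ ^ 2 * R ^ 2) *
            Real.exp (δ₀' / 2 * (cc + 1)) * Λ) / (L ^ ε - 1) * Real.exp (-(δ₀' / 2 * S.dist y y')) *
            (D.holderF (α + ε) f + D.supF f) * D.distX x₁ x₂ ^ α := by ring
  · rw [hE₂]
    calc |∑ j ∈ Finset.range S.k, termT D L d j μ ν f x₂|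
        ≤ ∑ j ∈ Finset.range S.k, |termT D L d j μ ν f x₂| := Finset.abs_sum_le_sum_abs _ _
      _ ≤ ∑ j ∈ Finset.range S.k, (c₀ + ā ^ 2 * c₀ ^ 3 * R ^ 2) *
            (B * (D.holderF (α + ε) f + 2 * D.supF f) * Λ * (L ^ ((j : ℝ) - S.k)) ^ (α + ε)) := by
          refine Finset.sum_le_sum fun j hj => ?_
          have h := termT_abs_le D L d c₀ δ₀' cc (cc + 1) (S.dist y y') ā R Λ (α + ε) hL hc₀ hδ.le he0 he1
            ha hleaf G Rw N (Finset.mem_range.mp hj) μ ν f x₂ hx₂ hsep2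
          rwa [← hB] at h
      _ = (c₀ + ā ^ 2 * c₀ ^ 3 * R ^ 2) * B * (D.holderF (α + ε) f + 2 * D.supF f) * Λ *
            ∑ j ∈ Finset.range S.k, (L ^ ((j : ℝ) - S.k)) ^ (α + ε) := by
          rw [Finset.mul_sum]
          exact Finset.sum_congr rfl fun j _ => by ring
      _ ≤ (c₀ + ā ^ 2 * c₀ ^ 3 * R ^ 2) * B * (D.holderF (α + ε) f + 2 * D.supF f) * Λ *
            (1 / (L ^ (α + ε) - 1)) :=
          mul_le_mul_of_nonneg_left (B5FromB4.scale_sum_bound L (α + ε) hL he0 S.k)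
            (mul_nonneg (mul_nonneg (mul_nonneg (by positivity) hB0) (by positivity)) hΛ0)
      _ ≤ (c₀ + ā ^ 2 * c₀ ^ 3 * R ^ 2) * B * (D.holderF (α + ε) f + 2 * D.supF f) * Λ *
            (1 / (L ^ ε - 1)) :=
          mul_le_mul_of_nonneg_left (inv_scale_gap_mono hL hε0 hα)
            (mul_nonneg (mul_nonneg (mul_nonneg (by positivity) hB0) (by positivity)) hΛ0)
      _ = (c₀ + ā ^ 2 * c₀ ^ 3 * R ^ 2) * (D.holderF (α + ε) f + 2 * D.supF f) *
            (B * Λ * (1 / (L ^ ε - 1))) := by ring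
      _ ≤ 4 * (2 * (c₀ + ā ^ 2 * c₀ ^ 3 * R ^ 2) + ā ^ 2 * c₁ * c₀ ^ 2 * R ^ 2) *
            (D.holderF (α + ε) f + D.supF f) * (B * Λ * (1 / (L ^ ε - 1))) := by
          refine mul_le_mul_of_nonneg_right ?_ (mul_nonneg (mul_nonneg hB0 hΛ0) hinv0)
          calc (c₀ + ā ^ 2 * c₀ ^ 3 * R ^ 2) * (D.holderF (α + ε) f + 2 * D.supF f)
              ≤ (2 * (c₀ + ā ^ 2 * c₀ ^ 3 * R ^ 2) + ā ^ 2 * c₁ * c₀ ^ 2 * R ^ 2) *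
                  (4 * (D.holderF (α + ε) f + D.supF f)) :=
                mul_le_mul (by linarith) (by linarith) (by positivity) (by positivity)
            _ = 4 * (2 * (c₀ + ā ^ 2 * c₀ ^ 3 * R ^ 2) + ā ^ 2 * c₁ * c₀ ^ 2 * R ^ 2) *
                  (D.holderF (α + ε) f + D.supF f) := by ring
      _ = 4 * ((2 * (c₀ + ā ^ 2 * c₀ ^ 3 * R ^ 2) + ā ^ 2 * c₁ * c₀ ^ 2 * R ^ 2) *
            Real.exp (δ₀' / 2 * (cc + 1)) * Λ) / (L ^ ε - 1) * Real.exp (-(δ₀' / 2 * S.dist y y')) *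
            (D.holderF (α + ε) f + D.supF f) := by
          rw [hB]; ring


/-! ## §5. The difference estimate ⟹ the entry (1.113) for G′; Lemma 2.4 (2.36) ⟹ the leaf; the hypothesis
`h113` of `B5Ineq137.h137_of_display136` discharged -/

/-- The difference estimate for the d² scalar quantities (∂_μG′∂*_νJ_ν)(x) gives the entry (1.113) of Prop. 1.2
for G′ with the constant multiplied by d (`Dict113`, and `Dict137` for supp J_ν ⊂ supp J, ‖J_ν‖ ≤ ‖J‖, |J_ν| ≤ |J|).
[cite: Balaban1984PropagatorsI, (1.113) p.36, p.40] -/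
theorem h2Entry_of_ineq113 (D : ScaleData S) {d : ℕ} (Dc : Dict137 D d) (Dc' : Dict113 D d)
    (Sg : B5FromB4.ModelSigns S) (hdist : ∀ x₁ x₂ : D.X, 0 ≤ D.distX x₁ x₂) {Cαε : ℝ → ℝ → ℝ} {δ : ℝ}
    (hC : ∀ α ε : ℝ, 0 ≤ α → 0 < ε → α + ε < 1 → 0 ≤ Cαε α ε)
    (h : ∀ α : ℝ, 0 ≤ α → α < 1 → Ineq113At D α (Cαε α) δ) :
    B5FromB4.H2Entry S (fun α ε => d * Cαε α ε) δ := by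
  intro α ε J ζ y y' hα0 hε0 hαε hζ hs
  show S.h2 J α ζ ≤ d * Cαε α ε * Real.exp (-(δ * S.dist y y')) * S.cutH α ζ *
    (S.holder (α + ε) J + S.supNorm J)
  have hC0 := hC α ε hα0 hε0 hαε
  have hJ0 : 0 ≤ S.holder (α + ε) J + S.supNorm J :=
    add_nonneg (Sg.holder_nonneg _ J) (Sg.supNorm_nonneg J)
  have hb0 : 0 ≤ Cαε α ε * Real.exp (-(δ * S.dist y y')) * (S.holder (α + ε) J + S.supNorm J) :=
    mul_nonneg (mul_nonneg hC0 (Real.exp_nonneg _)) hJ0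
  have h113 := h α hα0 (by linarith)
  have hpt : ∀ (μ ν : D.Dir) (x₁ x₂ : D.X), x₁ ∈ D.TX → x₂ ∈ D.TX → x₁ ≠ x₂ → D.distX x₁ x₂ ≤ 1 →
      D.cube x₁ y →
      |D.E μ ν (D.comp J ν) x₁ - D.E μ ν (D.comp J ν) x₂| ≤
          Cαε α ε * Real.exp (-(δ * S.dist y y')) * (S.holder (α + ε) J + S.supNorm J) *
            D.distX x₁ x₂ ^ α ∧
        |D.E μ ν (D.comp J ν) x₂| ≤
          Cαε α ε * Real.exp (-(δ * S.dist y y')) * (S.holder (α + ε) J + S.supNorm J) := by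
    intro μ ν x₁ x₂ hx₁ hx₂ hne hd hc
    obtain ⟨h1, h2⟩ := h113 ε μ ν (D.comp J ν) x₁ x₂ y y' hε0 hαε hx₁ hx₂ hne hd hc (Dc.supp J y' ν hs)
    have hmono : Cαε α ε * Real.exp (-(δ * S.dist y y')) *
          (D.holderF (α + ε) (D.comp J ν) + D.supF (D.comp J ν)) ≤
        Cαε α ε * Real.exp (-(δ * S.dist y y')) * (S.holder (α + ε) J + S.supNorm J) :=
      mul_le_mul_of_nonneg_left (add_le_add (Dc.holder_le _ J ν) (Dc.sup_le J ν))
        (mul_nonneg hC0 (Real.exp_nonneg _))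
    exact ⟨h1.trans (mul_le_mul_of_nonneg_right hmono (Real.rpow_nonneg (hdist x₁ x₂) _)), h2.trans hmono⟩
  calc S.h2 J α ζ ≤ d * S.cutH α ζ *
        (Cαε α ε * Real.exp (-(δ * S.dist y y')) * (S.holder (α + ε) J + S.supNorm J)) :=
      Dc'.h2_le J α ζ y _ hb0 hζ hpt
    _ = d * Cαε α ε * Real.exp (-(δ * S.dist y y')) * S.cutH α ζ * (S.holder (α + ε) J + S.supNorm J) := by
      ring

/-- **Lemma 2.4 (2.36) ⟹ the leaf estimate `Leaf236` on the kernel K1 of (1.136)** through `Dict236`, with the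
printed rate δ₀ (=: δ′₀) and the constant c₁ = c₁(α) of the "for α < 1, there exists a constant c₁" clause, the
set distance bounded by e^{−δ₀dist({x̃₁,x̃₂},y)} ≤ e^{−δ₀|x̃₁−y|} + e^{−δ₀|x̃₂−y|}. [cite: Balaban1983RegularityDecay, Lemma 2.4 (2.36) p.582] -/
theorem leaf236_of_lemma24 {I₂₄ : Type} {fam₂₄ : I₂₄ → B4.ScaleSetting} {α c₁ δ₀ : ℝ} (hc₁ : 0 ≤ c₁)
    (hδ₀ : 0 ≤ δ₀)
    (H236 : ∀ i : I₂₄, (fam₂₄ i).rectLarge →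
      ∀ (μ : (fam₂₄ i).Dir) (x x' : (fam₂₄ i).SiteF) (y : (fam₂₄ i).SiteU),
        (fam₂₄ i).lhs236 α μ x x' y ≤ c₁ * Real.exp (-(δ₀ * (fam₂₄ i).dist2F x x' y)))
    (D : ScaleData S) (L cc : ℝ) (hL : 0 ≤ L) (G : Geometry D L cc) (Dc : Dict236 fam₂₄ D L) :
    Leaf236 D L α c₁ δ₀ := by
  intro j hj1 hjk μ x₁ x₂ y hne
  obtain ⟨i, hrect, σ, τ, dir, hK, hd⟩ := Dc.mid j hj1 hjk
  have hP0 : 0 ≤ (L ^ (S.k - j) * D.distX x₁ x₂) ^ α :=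
    Real.rpow_nonneg (mul_nonneg (pow_nonneg hL _) (G.distX_nonneg _ _)) _
  calc |D.K1 j μ x₁ y - D.K1 j μ x₂ y|
      ≤ (fam₂₄ i).lhs236 α (dir μ) (σ x₁) (σ x₂) (τ y) * (L ^ (S.k - j) * D.distX x₁ x₂) ^ α :=
        hK α μ x₁ x₂ y hne
    _ ≤ c₁ * Real.exp (-(δ₀ * (fam₂₄ i).dist2F (σ x₁) (σ x₂) (τ y))) *
          (L ^ (S.k - j) * D.distX x₁ x₂) ^ α :=
        mul_le_mul_of_nonneg_right (H236 i hrect (dir μ) (σ x₁) (σ x₂) (τ y)) hP0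
    _ ≤ c₁ * (Real.exp (-(δ₀ * D.dXU j x₁ y)) + Real.exp (-(δ₀ * D.dXU j x₂ y))) *
          (L ^ (S.k - j) * D.distX x₁ x₂) ^ α :=
        mul_le_mul_of_nonneg_right
          (mul_le_mul_of_nonneg_left (exp_min_le_add hδ₀ (hd x₁ x₂ y)) hc₁) hP0
    _ = c₁ * (L ^ (S.k - j) * D.distX x₁ x₂) ^ α *
          (Real.exp (-(δ₀ * D.dXU j x₁ y)) + Real.exp (-(δ₀ * D.dXU j x₂ y))) := by ring

/-- **The hypothesis `h113` of `B5Ineq137.h137_of_display136` DISCHARGED, modulo located leaves** — *"The proof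
of (1.113) is similar"* (p. 40) made a kernel-checked derivation.  For the family of instances i = (k, T_η) of Prop.
1.2 for G′: the display (1.136) (`h136`), ∂*_ν1 = 0 at kernel level (`Z`), the dictionaries `Dict24`/`Dict236`
(torus ↔ Lemma 2.4 instances — the "whole torus" leaf) and `Dict137`/`Dict113` (scalar estimates ↔ the entries),
the model-evident geometry / lattice sums / norm facts / signs and |a_j| ≤ ā give: Lemma 2.4 of [2] (BY NAME, with
c₁ = c₁(α) CHOSEN from its "for α < 1" clause) ⟹ the second-order Hölder entry (1.113) for every instance, at rate
½δ₀ with O(1) = d·4(2(c₀′ + ā²c₀′³R²) + ā²c₁(α)c₀′²R²)e^{(1/2)δ₀(c+1)}Λ/(L^ε − 1), c₀′ = 4c₀e^{δ₀s₀}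
(`leaf_of_lemma24`, `leaf236_of_lemma24`, `ineq113At_of_display136`, `h2Entry_of_ineq113`). [cite: Balaban1984PropagatorsI, (1.113) p.36, pp.39–40] -/
theorem h113_of_display136 {I I₂₄ : Type} (fam₂₄ : I₂₄ → B4.ScaleSetting) (famGp : I → B5.Setting)
    (Dfam : ∀ i, ScaleData (famGp i)) (L : ℝ) (d : ℕ) (cc ā s₀ : ℝ) (hL : 1 < L) (hs₀ : 0 ≤ s₀)
    (ha : ∀ i j, |(Dfam i).a j| ≤ ā)
    (h136 : ∀ i, Display136 (Dfam i) L d) (Z : ∀ i, RowZero (Dfam i))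
    (D24 : ∀ i, Dict24 fam₂₄ (Dfam i) L s₀) (D236 : ∀ i, Dict236 fam₂₄ (Dfam i) L)
    (Dc : ∀ i, Dict137 (Dfam i) d) (Dc' : ∀ i, Dict113 (Dfam i) d)
    (G : ∀ i, Geometry (Dfam i) L cc) (G' : ∀ i, Geometry113 (Dfam i) L)
    (hRow : ∀ κ : ℝ, 0 < κ → ∃ R Λ : ℝ, ∀ i, RowSums (Dfam i) L d κ R Λ)
    (N : ∀ i, NormFacts (Dfam i)) (Sg : ∀ i, B5FromB4.ModelSigns (famGp i)) :
    B4.Lemma24Printed fam₂₄ →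
      ∃ δ₂ : ℝ, ∃ Cαε : ℝ → ℝ → ℝ, 0 < δ₂ ∧ ∀ i, B5FromB4.H2Entry (famGp i) Cαε δ₂ := by
  intro h24
  obtain ⟨c₀, δ₀, hc₀, hδ₀, H24, H236⟩ := h24
  obtain ⟨R, Λ, hRw⟩ := hRow (δ₀ / 4) (by positivity)
  have hL0 : 0 < L := lt_trans zero_lt_one hL
  -- c₁ = c₁(α), CHOSEN from "for α < 1, there exists a constant c₁" (and 0, never used, for α ≥ 1)
  have hc₁f : ∀ α : ℝ, ∃ c₁ : ℝ, 0 ≤ c₁ ∧ (α < 1 → ∀ i : I₂₄, (fam₂₄ i).rectLarge →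
      ∀ (μ : (fam₂₄ i).Dir) (x x' : (fam₂₄ i).SiteF) (y : (fam₂₄ i).SiteU),
        (fam₂₄ i).lhs236 α μ x x' y ≤ c₁ * Real.exp (-(δ₀ * (fam₂₄ i).dist2F x x' y))) := by
    intro α
    by_cases hα : α < 1
    · obtain ⟨c₁, hc₁, h⟩ := H236 α hα
      exact ⟨c₁, hc₁.le, fun _ => h⟩
    · exact ⟨0, le_rfl, fun h => absurd h hα⟩
  choose c₁ hc₁0 hc₁ using hc₁f
  obtain ⟨c₀', hc₀'⟩ : ∃ c : ℝ, c = 4 * c₀ * Real.exp (δ₀ * s₀) := ⟨_, rfl⟩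
  have hc₀'0 : 0 ≤ c₀' := by rw [hc₀']; positivity
  have hleaf : ∀ i, Leaf235to237 (Dfam i) L c₀' δ₀ := fun i => by
    rw [hc₀']; exact leaf_of_lemma24 hc₀ hδ₀ H24 (Dfam i) L s₀ hs₀ (D24 i)
  have h236 : ∀ (i : I) (α : ℝ), α < 1 → Leaf236 (Dfam i) L α (c₁ α) δ₀ := fun i α hα =>
    leaf236_of_lemma24 (hc₁0 α) hδ₀.le (hc₁ α hα) (Dfam i) L cc hL0.le (G i) (D236 i)
  refine ⟨δ₀ / 2, fun α ε => d * (4 * ((2 * (c₀' + ā ^ 2 * c₀' ^ 3 * R ^ 2) +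
      ā ^ 2 * c₁ α * c₀' ^ 2 * R ^ 2) * Real.exp (δ₀ / 2 * (cc + 1)) * Λ) / (L ^ ε - 1)),
    half_pos hδ₀, fun i => ?_⟩
  have hC : ∀ α ε : ℝ, 0 ≤ α → 0 < ε → α + ε < 1 →
      0 ≤ 4 * ((2 * (c₀' + ā ^ 2 * c₀' ^ 3 * R ^ 2) + ā ^ 2 * c₁ α * c₀' ^ 2 * R ^ 2) *
        Real.exp (δ₀ / 2 * (cc + 1)) * Λ) / (L ^ ε - 1) := by
    intro α ε _ hε0 _
    have hLε : 0 < L ^ ε - 1 := by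
      have := Real.one_lt_rpow hL hε0
      linarith
    have hΛ : 0 ≤ Λ := (hRw i).Λ_nonneg
    have := hc₁0 α
    exact div_nonneg (by positivity) hLε.le
  exact h2Entry_of_ineq113 (Dfam i) (Dc i) (Dc' i) (Sg i) (G i).distX_nonneg
    (Cαε := fun α ε => 4 * ((2 * (c₀' + ā ^ 2 * c₀' ^ 3 * R ^ 2) + ā ^ 2 * c₁ α * c₀' ^ 2 * R ^ 2) *
      Real.exp (δ₀ / 2 * (cc + 1)) * Λ) / (L ^ ε - 1)) hC
    (fun α hα0 hα1 => ineq113At_of_display136 (Dfam i) L d c₀' (c₁ α) δ₀ cc ā R Λ α hL hc₀'0 (hc₁0 α) hδ₀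
      hα0 (ha i) (h136 i) (Z i) (hleaf i) (h236 i α hα1) (G i) (G' i) (hRw i) (N i))

/-- **`B5Ineq137.h137_of_display136` with its hypothesis `h113` discharged**: Lemma 2.4 of [2] ⟹ BOTH second-order
entries (1.112)–(1.113) of Prop. 1.2 for G′, kernel-checked from the display (1.136) and the estimates (2.35)–(2.37),
modulo the located leaves (`Display136`, `Dict24`, `Dict236`, the model-evident structures). [cite: Balaban1984PropagatorsI, (1.135)–(1.137) pp.39–40] -/
theorem h137_of_display136' {I I₂₄ : Type} (fam₂₄ : I₂₄ → B4.ScaleSetting) (famGp : I → B5.Setting)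
    (Dfam : ∀ i, ScaleData (famGp i)) (L : ℝ) (d : ℕ) (cc ā s₀ : ℝ) (hL : 1 < L) (hs₀ : 0 ≤ s₀)
    (ha : ∀ i j, |(Dfam i).a j| ≤ ā)
    (h136 : ∀ i, Display136 (Dfam i) L d) (Z : ∀ i, RowZero (Dfam i))
    (D24 : ∀ i, Dict24 fam₂₄ (Dfam i) L s₀) (D236 : ∀ i, Dict236 fam₂₄ (Dfam i) L)
    (Dc : ∀ i, Dict137 (Dfam i) d) (Dc' : ∀ i, Dict113 (Dfam i) d)
    (G : ∀ i, Geometry (Dfam i) L cc) (G' : ∀ i, Geometry113 (Dfam i) L)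
    (hRow : ∀ κ : ℝ, 0 < κ → ∃ R Λ : ℝ, ∀ i, RowSums (Dfam i) L d κ R Λ)
    (N : ∀ i, NormFacts (Dfam i)) (Sg : ∀ i, B5FromB4.ModelSigns (famGp i)) :
    B4.Lemma24Printed fam₂₄ → B5FromB4.SecondOrderFam famGp :=
  h137_of_display136 fam₂₄ famGp Dfam L d cc ā s₀ hL hs₀ ha h136 D24 Dc G hRow N Sg
    (h113_of_display136 fam₂₄ famGp Dfam L d cc ā s₀ hL hs₀ ha h136 Z D24 D236 Dc Dc' G G' hRow N Sg)

/-- **`B5FromB4.prop12G0_of_B4` with `h137` AND `h113` discharged**: S3 of B5 Prop. 1.2 from [2] = B4 with both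
second-order entries kernel-checked from (1.135)–(1.137) and (2.35)–(2.37) — B4's Theorem (printed dependence) and
Lemma 2.4 by name, the dictionaries, the model-evident facts, and the passage's remaining sentences ("Prop. 1.1 for
G₀", "(1.114) … random walk", "(1.133) … weak bounds", the residual first-order entries) as the named hypotheses they
are in `B5FromB4`. [cite: Balaban1984PropagatorsI, pp.39–40] -/
theorem prop12G0_of_B4_via137_113 {I I₄ I₂₄ : Type} (fam₄ : I₄ → B4.EtaSetting)
    (fam₂₄ : I₂₄ → B4.ScaleSetting) (famGp famG0 : I → B5.Setting) (F : ∀ i, B5FromB4.GpHolder (famGp i))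
    (c : ℝ) (ι : I → ℝ → I₄)
    (Dι : ∀ (i : I) (e : ℝ), 0 < e → B5FromB4.Dict (fam₄ (ι i e)) (famGp i) (F i) c e)
    (SgGp : ∀ i, B5FromB4.ModelSigns (famGp i)) (SgG0 : ∀ i, B5FromB4.ModelSigns (famG0 i))
    (hThm : B5FromB4.ThmDepPrinted fam₄) (h24 : B4.Lemma24Printed fam₂₄)
    (hRes : B5FromB4.ResidualGpFirst famGp F)
    (Dfam : ∀ i, ScaleData (famGp i)) (L : ℝ) (d : ℕ) (cc ā s₀ : ℝ) (hL : 1 < L) (hs₀ : 0 ≤ s₀)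
    (ha : ∀ i j, |(Dfam i).a j| ≤ ā)
    (h136 : ∀ i, Display136 (Dfam i) L d) (Z : ∀ i, RowZero (Dfam i))
    (D24 : ∀ i, Dict24 fam₂₄ (Dfam i) L s₀) (D236 : ∀ i, Dict236 fam₂₄ (Dfam i) L)
    (Dc : ∀ i, Dict137 (Dfam i) d) (Dc' : ∀ i, Dict113 (Dfam i) d)
    (G : ∀ i, Geometry (Dfam i) L cc) (G' : ∀ i, Geometry113 (Dfam i) L)
    (hRow : ∀ κ : ℝ, 0 < κ → ∃ R Λ : ℝ, ∀ i, RowSums (Dfam i) L d κ R Λ)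
    (N : ∀ i, NormFacts (Dfam i))
    (h11G0 : B5.Prop11Printed famG0)
    (h114G0 : B5.Prop11Printed famG0 → B5.Local114Fam famG0)
    (transfer : B5FromB4.FirstOrderFam famGp → B5FromB4.SecondOrderFam famGp → B5.Local114Fam famG0 →
      B5FromB4.FirstOrderFam famG0 ∧ B5FromB4.SecondOrderFam famG0) :
    B5.Prop12Printed famG0 :=
  B5FromB4.prop12G0_of_B4 fam₄ fam₂₄ famGp famG0 F c ι Dι SgGp SgG0 hThm h24 hRes
    (h137_of_display136' fam₂₄ famGp Dfam L d cc ā s₀ hL hs₀ ha h136 Z D24 D236 Dc Dc' G G' hRow N SgGp)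
    h11G0 h114G0 transfer

end Literature.MathematicalPhysics.QuantumFieldTheory.Balaban1983to89.B5Ineq113
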